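import Literature.NumberTheory.Sieve.ShiuBrunTitchmarsh
import Literature.NumberTheory.Sieve.ShiftedWindowSieve
import Literature.NumberTheory.Sieve.SmoothRoughDecomposition
import Literature.NumberTheory.Sieve.RankinSmoothNumbers
import HarnessLib

/-!
# Proof of Shiu's Brun–Titchmarsh theorem for multiplicative functions

Topic `Literature/NumberTheory/Sieve`.  This file DISCHARGES the named fact
`Literature.NumberTheory.Sieve.Shiu1980BrunTitchmarsh` of `ShiuBrunTitchmarsh.lean` (whose other
fact, BFI 1986 Lemma 3, is discharged independently in `ShiuBrunTitchmarshProofs.lean`)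
(P. Shiu, *A Brun–Titchmarsh theorem for multiplicative functions*, J. reine angew. Math. 313
(1980) 161–170, Theorem 1; O. Bordellès, *Arithmetic Tales*, Thm 4.17):
`theorem Shiu1980BrunTitchmarsh_holds : Shiu1980BrunTitchmarsh`, sorry-free, from the tree's sieve
and Rankin machinery.  Everything else in the file (namespace `Literature.NumberTheory.Sieve.Shiu`)
is bookkeeping for that one proof: elementary definitions with bodies and proved lemmas, no named
facts.

## The argument (Shiu 1980, §§2–5; detailed modern account: arXiv:2508.17217, §§5, 7, 8)

Fix `f ≥ 0` multiplicative with `f(p^l) ≤ A₁^l`, `f(n) ≤ A₂(δ) n^δ`; `0 < ε, θ < 1/2`;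
`x^ε ≤ y ≤ x`, `q < y^{1-θ}`, `(a, q) = 1`.  Put `w = y^{θ/20}`, `z = w²`.  Every `n` of the
progression in `(x, x + y]` is cut as `n = c_n d_n` (`Shiu.cutPrime`, `Shiu.cPart`, `Shiu.dPart`):
`c_n` is the largest initial segment `∏_{p < P_n} p^{v_p(n)} ≤ z` of its factorisation, `P_n` the
"cut prime", so that `z < c_n P_n^{v_{P_n}(n)}` (`Shiu.lt_cPart_mul_pow`).  Four classes:

* I (`P_n > w`): `d_n` has all prime factors `> w`, so `f(d_n) ≤ B^{Ω(d_n)} ≤ B^M`; for each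
  `c ≤ z`, `(c, q) = 1`, the `d` lie in a segment of a reduced class and are free of primes `< w`:
  the segment sieve (`Shiu.segment_sieve_bound`, = Shiu's Lemma 2, here the tree's Fundamental
  Lemma `ShiftedWindowSieve.abs_apSiftedCount_sub_le` with `∏_{p<w,p∤q}(1-1/p) ≤ (q/φ(q))/log w`)
  counts them, and `∑_{c ≤ z,(c,q)=1} f(c)/c ≤ e^{K₅} exp(∑_{p ≤ z, p∤q} f(p)/p)`
  (`Shiu.euler_majorant`, Shiu's eq. (2.2), via `BombieriSieve.sum_le_prod_tsum_of_factored`).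
* II (`P_n ≤ w`, `c_n ≤ w`): `P_n^{e} ∣ n` with `P_n^e > w`, `e ≥ 2`; counting multiples of
  `P^{e_P}` in the progression and `∑_{P ≤ w} P^{-e_P} ≤ 7 w^{-1/3}`, with `f(n) ≤ F = 2A₂(δ₀)x^{δ₀}`.
* III (`c_n > w`, `P_n ≤ L`): `c_n ∈ (w, z]` is `L`-smooth; Rankin's trick with exponent `1/3`
  (`sum_div_le_rankin`) and the Rankin count of smooth numbers (`card_smoothNumbersUpTo_le_rankin`).
* IV (`c_n > w`, `L < P_n ≤ w`): with `r = ⌊log z / log P_n⌋ ∈ [2, log z/log L]`, `d_n` has all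
  prime factors `> z^{1/(r+1)}` so `f(d_n) ≤ B^{(r+1)M₁}` and the `d` are sifted to level
  `z^{1/(r+1)}`; the `c` are `> w`, `z^{1/r}`-smooth, and Rankin's trick with the UNIFORM exponent
  `η = K₁ r/log z ≤ 1/6` (`Shiu.rankin_tail`, Shiu's Lemma 3 with the Mertens step
  `∑_{p<v}(f(p)/p)(p^η - 1) ≤ B η v^η (log v + log 4)`) saves `w^{-η} = e^{-K₁ r/2}`, which with
  `K₁ = 2M₁ log B + 4 log 2` beats `B^{(r+1)M₁}(r+1)`; summing `2^{-r}` over `r` ends the proof.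

## Design choices and deviations from the printed proof

* Shiu takes the Rankin exponent `1 - δ = c r log r / log z` (saving `e^{-c' r log r}`) and the
  class-III threshold `L = log x log log x`; since the growth to beat, `A₁^{Ω(d)} ≤ A₁^{(r+1)M₁}`, is
  only exponential in `r`, the LINEAR exponent `η = K₁ r / log z` suffices and makes the class-III
  threshold the CONSTANT `L = e^{6K₁}` (so class III is Rankin with a fixed exponent).  The
  statement proved is exactly the vendored one; only the (unprinted) implied constant differs.
* The implied constant is `Shiu.Ctot` (explicit in `A₁, A₂(1/6), ε, θ`, the tree's sieve constant
  and `∑ n^{-5/3}`); the threshold `x₀` is extracted from finitely many conditions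
  `K x^α log x ≤ x^β` (`Shiu.eventually_mul_rpow_mul_log_le`) and `x^ε ≥ 2^{20/θ}`; neither is
  optimised.  The case `f(1) ≠ 1` forces `f ≡ 0` and is trivial.
* Three declarations (`classIV_r_bound`, `main_bound`, the final theorem) carry a raised
  `maxHeartbeats`: they are long but elementary assemblies of the class bounds.
* Not here: Nair–Tenenbaum's generalisation (Bordellès Thm 4.18), explicit constants, the lower
  bound direction.

## References

* P. Shiu, J. reine angew. Math. 313 (1980), 161–170: Theorem 1, Lemma 2 (sifted progression),
  Lemma 3 (Rankin), §5 (the classes I–IV). [Shiu1980]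
* O. Bordellès, *Arithmetic Tales. Advanced Edition*, Universitext 2020, Theorem 4.17 and the
  sketch following it (held copy pp. 163–165). [Bordelles2006]
* H. L. Montgomery, R. C. Vaughan, *Multiplicative Number Theory I*, §7.1 (Rankin's method).
  [MontgomeryVaughan2007]
-/

noncomputable section

open Finset Real

namespace Literature.NumberTheory.Sieve

namespace Shiu

/-! ### Multiplicative functions bounded on prime powers -/

/-- `Ω' d = ∑_p v_p(d)`, the number of prime factors of `d` counted with multiplicity, written as
a sum over the factorization (this is `Ω d`; only the two inequalities below are needed). [folklore] -/
def bigOmega (d : ℕ) : ℕ := d.factorization.sum fun _ e => e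

/-- For `f` multiplicative on coprime arguments with `f 1 = 1`, `0 ≤ f` and `f(p^l) ≤ B^l`
(`B ≥ 1`): `f d ≤ B ^ Ω'(d)` for `d ≠ 0`. [folklore] -/
theorem le_pow_bigOmega {f : ℕ → ℝ} (hf0 : ∀ n, 0 ≤ f n) (hf1 : f 1 = 1)
    (hmul : ∀ m n : ℕ, m.Coprime n → f (m * n) = f m * f n) {B : ℝ}
    (hB : ∀ p l : ℕ, p.Prime → 1 ≤ l → f (p ^ l) ≤ B ^ l) {d : ℕ} (hd : d ≠ 0) :
    f d ≤ B ^ bigOmega d := by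
  rw [Nat.multiplicative_factorization f hmul hf1 hd, bigOmega, Finsupp.prod, Finsupp.sum,
    ← Finset.prod_pow_eq_pow_sum]
  refine Finset.prod_le_prod (fun p _ => hf0 _) fun p hp => ?_
  have hpp : p.Prime := Nat.prime_of_mem_primeFactors hp
  have h1 : 1 ≤ d.factorization p := by
    rw [← hpp.dvd_iff_one_le_factorization hd]
    exact Nat.dvd_of_mem_primeFactors hp
  exact hB p _ hpp h1

/-- If every prime factor of `d ≠ 0` is `≥ u > 0` then `u ^ Ω'(d) ≤ d`. [folklore] -/
theorem pow_bigOmega_le {d : ℕ} (hd : d ≠ 0) {u : ℝ} (hu : 0 ≤ u)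
    (h : ∀ p ∈ d.primeFactors, u ≤ (p : ℝ)) : u ^ bigOmega d ≤ (d : ℝ) := by
  conv_rhs => rw [← Nat.prod_factorization_pow_eq_self hd]
  rw [bigOmega, Finsupp.sum, ← Finset.prod_pow_eq_pow_sum, Finsupp.prod, Nat.cast_prod]
  refine Finset.prod_le_prod (fun p _ => by positivity) fun p hp => ?_
  rw [Nat.cast_pow]
  exact pow_le_pow_left₀ hu (h p hp) _

/-- If every prime factor of `d ≠ 0` is `≥ u > 1` and `d ≤ X` then `Ω'(d) ≤ log X / log u`. [folklore] -/
theorem bigOmega_le_div_log {d : ℕ} (hd : d ≠ 0) {u X : ℝ} (hu : 1 < u)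
    (h : ∀ p ∈ d.primeFactors, u ≤ (p : ℝ)) (hX : (d : ℝ) ≤ X) :
    (bigOmega d : ℝ) ≤ Real.log X / Real.log u := by
  have hlogu : 0 < Real.log u := Real.log_pos hu
  have hd0 : (0 : ℝ) < d := by exact_mod_cast Nat.pos_of_ne_zero hd
  rw [le_div_iff₀ hlogu, ← Real.log_pow]
  exact Real.log_le_log (pow_pos (by linarith) _) ((pow_bigOmega_le hd (by linarith) h).trans hX)

/-! ### The cut prime and the decomposition `n = c_n d_n` -/

/-- The cut prime `P_n`: the largest prime factor `p` of `n` whose smooth part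
`smoothPart p n = ∏_{q < p} q^{v_q(n)}` is `≤ z` (`0` if there is none, i.e. for `n ≤ 1`).
[cite: Shiu1980, §5 (the decomposition n = p₁^{u₁}⋯p_j^{u_j} · p_{j+1}^{u_{j+1}}⋯)] -/
def cutPrime (z : ℝ) (n : ℕ) : ℕ :=
  (n.primeFactors.filter fun p => (smoothPart p n : ℝ) ≤ z).sup id

/-- The smooth factor `c_n = smoothPart P_n n`. [cite: Shiu1980, §5] -/
def cPart (z : ℝ) (n : ℕ) : ℕ := smoothPart (cutPrime z n) n

/-- The rough cofactor `d_n = n / c_n`. [cite: Shiu1980, §5] -/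
def dPart (z : ℝ) (n : ℕ) : ℕ := n / cPart z n

/-- The smooth part at a threshold below every prime is `1`. [folklore] -/
theorem smoothPart_eq_one_of_forall {B n : ℕ} (h : ∀ p ∈ n.primeFactors, B ≤ p) :
    smoothPart B n = 1 := by
  rw [smoothPart_def]
  refine Finset.prod_eq_one fun p hp => ?_
  obtain ⟨hp, hpB⟩ := Finset.mem_filter.1 hp
  exact absurd hpB (not_lt.2 (h p hp))

/-- Raising the threshold past a prime `P`: `smoothPart (P+1) n = smoothPart P n * P^{v_P(n)}`. [folklore] -/
theorem smoothPart_succ (P n : ℕ) (hP : P.Prime) :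
    smoothPart (P + 1) n = smoothPart P n * P ^ n.factorization P := by
  refine Nat.eq_of_factorization_eq (smoothPart_ne_zero _ _)
    (mul_ne_zero (smoothPart_ne_zero _ _) (pow_ne_zero _ hP.ne_zero)) fun q => ?_
  rw [Nat.factorization_mul (smoothPart_ne_zero _ _) (pow_ne_zero _ hP.ne_zero),
    Finsupp.add_apply, factorization_smoothPart, factorization_smoothPart, hP.factorization_pow,
    Finsupp.single_apply]
  by_cases hqP : q < P
  · rw [if_pos (Nat.lt_succ_of_lt hqP), if_pos hqP, if_neg (by omega), add_zero]
  · by_cases heq : P = q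
    · subst heq
      rw [if_pos (Nat.lt_succ_self _), if_neg hqP, if_pos rfl, zero_add]
    · rw [if_neg (by omega), if_neg hqP, if_neg heq, add_zero]

/-- The smooth part does not change between thresholds with no prime factor in between. [folklore] -/
theorem smoothPart_eq_of_no_primeFactors {B B' n : ℕ} (hBB' : B ≤ B')
    (h : ∀ p ∈ n.primeFactors, p < B' → p < B) : smoothPart B' n = smoothPart B n := by
  rw [smoothPart_def, smoothPart_def]
  refine Finset.prod_congr ?_ fun _ _ => rfl
  ext p
  simp only [Finset.mem_filter]
  exact ⟨fun ⟨hp, hpB'⟩ => ⟨hp, h p hp hpB'⟩, fun ⟨hp, hpB⟩ => ⟨hp, lt_of_lt_of_le hpB hBB'⟩⟩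

/-- The smooth part at a threshold above every prime factor is `n` itself (`n ≠ 0`). [folklore] -/
theorem smoothPart_eq_self_of_forall {B n : ℕ} (hn : n ≠ 0) (h : ∀ p ∈ n.primeFactors, p < B) :
    smoothPart B n = n := by
  rw [smoothPart_def, Finset.filter_true_of_mem h]
  exact Nat.prod_factorization_pow_eq_self hn

variable {z : ℝ} {n : ℕ}

/-- **Basic properties of the cut prime** (`n ≥ 2`, `1 ≤ z`): `P_n` is a prime factor of `n` and
`c_n ≤ z`. [folklore] -/
theorem cutPrime_mem (hn : 2 ≤ n) (hz : 1 ≤ z) :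
    cutPrime z n ∈ n.primeFactors ∧ (cPart z n : ℝ) ≤ z := by
  set T := n.primeFactors.filter fun p => (smoothPart p n : ℝ) ≤ z with hT
  have hn0 : n ≠ 0 := by omega
  -- the least prime factor belongs to `T`
  have hne : T.Nonempty := by
    refine ⟨n.minFac, Finset.mem_filter.2 ⟨Nat.mem_primeFactors.2 ⟨Nat.minFac_prime (by omega),
      Nat.minFac_dvd n, hn0⟩, ?_⟩⟩
    rw [smoothPart_eq_one_of_forall fun p hp => Nat.minFac_le_of_dvd
      (Nat.prime_of_mem_primeFactors hp).two_le (Nat.dvd_of_mem_primeFactors hp)]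
    simpa using hz
  obtain ⟨P, hPT, hPeq⟩ := Finset.exists_mem_eq_sup T hne id
  have hcut : cutPrime z n = P := hPeq
  obtain ⟨hP, hPz⟩ := Finset.mem_filter.1 hPT
  refine ⟨hcut ▸ hP, ?_⟩
  rw [cPart, hcut]
  exact hPz

/-- Maximality of the cut prime: a prime factor with smooth part `≤ z` is `≤ P_n`. [folklore] -/
theorem le_cutPrime {p : ℕ} (hp : p ∈ n.primeFactors) (hpz : (smoothPart p n : ℝ) ≤ z) :
    p ≤ cutPrime z n :=
  Finset.le_sup (f := id) (Finset.mem_filter.2 ⟨hp, hpz⟩)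

/-- **The cut**: for `n ≥ 2`, `1 ≤ z < n`: `z < smoothPart (P_n + 1) n = c_n · P_n^{v_{P_n}(n)}`. [folklore] -/
theorem lt_cPart_mul_pow (hn : 2 ≤ n) (hz : 1 ≤ z) (hzn : z < n) :
    z < (cPart z n : ℝ) * (cutPrime z n : ℝ) ^ n.factorization (cutPrime z n) := by
  have hn0 : n ≠ 0 := by omega
  obtain ⟨hPmem, -⟩ := cutPrime_mem hn hz
  set P := cutPrime z n with hPdef
  have hP : P.Prime := Nat.prime_of_mem_primeFactors hPmem
  have key : z < (smoothPart (P + 1) n : ℝ) := by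
    by_contra hle
    rw [not_lt] at hle
    -- the prime factors above `P`
    set U := n.primeFactors.filter fun q => P < q with hU
    by_cases hUe : U = ∅
    · -- no prime factor above `P`: the smooth part is `n`
      have hall : ∀ q ∈ n.primeFactors, q < P + 1 := by
        intro q hq
        by_contra hq'
        have : q ∈ U := Finset.mem_filter.2 ⟨hq, by omega⟩
        rw [hUe] at this
        exact Finset.notMem_empty q this
      rw [smoothPart_eq_self_of_forall hn0 hall] at hle
      exact absurd (lt_of_lt_of_le hzn hle) (lt_irrefl _)
    · obtain ⟨p', hp'⟩ := Finset.nonempty_iff_ne_empty.2 hUe |>.exists_mem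
      -- the least prime factor above `P`
      set p₁ := U.min' (Finset.nonempty_iff_ne_empty.2 hUe) with hp₁
      have hp₁U : p₁ ∈ U := Finset.min'_mem U _
      obtain ⟨hp₁n, hPp₁⟩ := Finset.mem_filter.1 hp₁U
      have hsame : smoothPart p₁ n = smoothPart (P + 1) n := by
        refine smoothPart_eq_of_no_primeFactors (by omega) fun q hq hqp₁ => ?_
        by_contra hqP
        have hqU : q ∈ U := Finset.mem_filter.2 ⟨hq, by omega⟩
        exact absurd (Finset.min'_le U q hqU) (not_le.2 (hp₁ ▸ hqp₁))
      have h1 : (smoothPart p₁ n : ℝ) ≤ z := by rw [hsame]; exact hle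
      have h2 : p₁ ≤ P := le_cutPrime hp₁n h1
      clear hp'
      omega
  rw [smoothPart_succ P n hP, Nat.cast_mul, Nat.cast_pow] at key
  exact key

/-- `c_n ∣ n`. [folklore] -/
theorem cPart_dvd (hn : n ≠ 0) : cPart z n ∣ n := smoothPart_dvd hn _

/-- `c_n ≠ 0`. [folklore] -/
theorem cPart_ne_zero : cPart z n ≠ 0 := smoothPart_ne_zero _ _

/-- `c_n * d_n = n`. [folklore] -/
theorem cPart_mul_dPart (hn : n ≠ 0) : cPart z n * dPart z n = n := smoothPart_mul_div hn _

/-- `(c_n, d_n) = 1`. [folklore] -/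
theorem coprime_cPart_dPart (hn : n ≠ 0) : (cPart z n).Coprime (dPart z n) :=
  coprime_smoothPart_div hn

/-- `d_n ≠ 0`. [folklore] -/
theorem dPart_ne_zero (hn : n ≠ 0) : dPart z n ≠ 0 := by
  intro h
  have := cPart_mul_dPart (z := z) hn
  rw [h, mul_zero] at this
  exact hn this.symm

/-- Every prime factor of `c_n` is `< P_n`. [folklore] -/
theorem lt_of_mem_primeFactors_cPart {p : ℕ} (hp : p ∈ (cPart z n).primeFactors) :
    p < cutPrime z n :=
  (Nat.mem_smoothNumbers'.1 (smoothPart_mem_smoothNumbers _ _)) p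
    (Nat.prime_of_mem_primeFactors hp) (Nat.dvd_of_mem_primeFactors hp)

/-- Every prime factor of `d_n` is `≥ P_n`. [folklore] -/
theorem cutPrime_le_of_mem_primeFactors_dPart (hn : n ≠ 0) {p : ℕ}
    (hp : p ∈ (dPart z n).primeFactors) : cutPrime z n ≤ p :=
  le_of_prime_dvd_div_smoothPart hn (Nat.prime_of_mem_primeFactors hp)
    (Nat.dvd_of_mem_primeFactors hp)

/-- `P_n ^ {v_{P_n}(n)} ∣ d_n` (for `n ≥ 2`, `1 ≤ z`). [folklore] -/
theorem pow_dvd_dPart (hn : 2 ≤ n) (hz : 1 ≤ z) :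
    cutPrime z n ^ n.factorization (cutPrime z n) ∣ dPart z n := by
  have hn0 : n ≠ 0 := by omega
  obtain ⟨hPmem, -⟩ := cutPrime_mem hn hz
  have hP : (cutPrime z n).Prime := Nat.prime_of_mem_primeFactors hPmem
  have hcop : (cutPrime z n ^ n.factorization (cutPrime z n)).Coprime (cPart z n) := by
    refine Nat.Coprime.pow_left _ (hP.coprime_iff_not_dvd.2 fun hdvd => ?_)
    have hmem : cutPrime z n ∈ (cPart z n).primeFactors :=
      Nat.mem_primeFactors.2 ⟨hP, hdvd, cPart_ne_zero⟩
    exact lt_irrefl _ (lt_of_mem_primeFactors_cPart hmem)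
  have hdvd : cutPrime z n ^ n.factorization (cutPrime z n) ∣ cPart z n * dPart z n := by
    rw [cPart_mul_dPart hn0]
    exact Nat.ordProj_dvd n _
  exact hcop.dvd_of_dvd_mul_left hdvd
/-! ### The Euler-product majorant, uniformly in a Rankin exponent `η ≤ 1/6` -/

/-- `(p^a)^t = (p^t)^a` for real `t` and natural `a`. [folklore] -/
theorem rpow_pow_comm (p a : ℕ) (t : ℝ) : (((p : ℝ)) ^ a) ^ t = ((p : ℝ) ^ t) ^ a := by
  rw [← Real.rpow_natCast_mul (Nat.cast_nonneg p), mul_comm, Real.rpow_mul_natCast (Nat.cast_nonneg p)]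

/-- The constant `K₅(A, B) = 4A ⌈(2B)²⌉ + 4B² ∑_n n^{-5/3}` bounding the higher prime-power
contributions to the Euler factors. [folklore] -/
def K₅ (A B : ℝ) : ℝ := 4 * A * (⌈(2 * B) ^ 2⌉₊ : ℝ) + 4 * B ^ 2 * ∑' m : ℕ, (m : ℝ) ^ (-(5 / 3 : ℝ))

/-- `∑ n^{-5/3}` converges. [folklore] -/
theorem summable_rpow_neg_five_thirds : Summable fun m : ℕ => (m : ℝ) ^ (-(5 / 3 : ℝ)) :=
  Real.summable_nat_rpow.2 (by norm_num)

/-- `K₅ ≥ 0` for `A ≥ 0`. [folklore] -/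
theorem K₅_nonneg {A B : ℝ} (hA : 0 ≤ A) : 0 ≤ K₅ A B := by
  unfold K₅
  have : 0 ≤ ∑' m : ℕ, (m : ℝ) ^ (-(5 / 3 : ℝ)) := tsum_nonneg fun m => by positivity
  positivity

/-- **Euler-product majorant with a Rankin exponent.**  Let `f ≥ 0` be multiplicative on coprime
arguments, `f 1 = 1`, `f(p^l) ≤ B^l` (`B ≥ 1`) and `f(n) ≤ A n^{1/6}`.  For `0 ≤ η ≤ 1/6`, a finite
set of primes `s` and a finite set `S` of `s`-factored numbers,
`∑_{c ∈ S} f(c) c^{η-1} ≤ exp(∑_{p ∈ s} f(p) p^{η-1} + K₅(A,B))`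
(Shiu 1980, Lemma 1/eq. (2.2): `∑ f(n)/n^δ ≪ exp(∑_p f(p)/p^δ)` for `δ > 3/4`; here `δ = 1 - η`).
[cite: Shiu1980, §2 (Euler product bound, δ > 3/4)] -/
theorem euler_majorant {f : ℕ → ℝ} (hf0 : ∀ n, 0 ≤ f n) (hf1 : f 1 = 1)
    (hmul : ∀ m n : ℕ, m.Coprime n → f (m * n) = f m * f n)
    {B : ℝ} (hB1 : 1 ≤ B) (hB : ∀ p l : ℕ, p.Prime → 1 ≤ l → f (p ^ l) ≤ B ^ l)
    {A : ℝ} (hA : ∀ n : ℕ, 1 ≤ n → f n ≤ A * (n : ℝ) ^ (1 / 6 : ℝ))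
    {η : ℝ} (hη : η ≤ 1 / 6)
    {s : Finset ℕ} (hs : ∀ p ∈ s, p.Prime) {S : Finset ℕ} (hS : ∀ c ∈ S, c ∈ Nat.factoredNumbers s) :
    ∑ c ∈ S, f c * (c : ℝ) ^ (η - 1) ≤
      Real.exp (∑ p ∈ s, f p * (p : ℝ) ^ (η - 1) + K₅ A B) := by
  have hA1 : 1 ≤ A := by have := hA 1 le_rfl; rw [hf1] at this; simpa using this
  have hA0 : 0 ≤ A := by linarith
  -- the weight
  set h : ℕ → ℝ := fun c => f c * (c : ℝ) ^ (η - 1) with hh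
  have hh0 : ∀ c, 0 ≤ h c := fun c => mul_nonneg (hf0 c) (by positivity)
  have hh1 : h 1 = 1 := by simp [hh, hf1]
  have hhmul : ∀ {m n : ℕ}, Nat.Coprime m n → h (m * n) = h m * h n := by
    intro m n hmn
    simp only [hh]
    rw [hmul m n hmn, Nat.cast_mul, Real.mul_rpow (by positivity) (by positivity)]
    ring
  -- prime powers: `h(p^a) = f(p^a) (p^{η-1})^a`
  have hpa : ∀ p a : ℕ, h (p ^ a) = f (p ^ a) * ((p : ℝ) ^ (η - 1)) ^ a := by
    intro p a
    simp only [hh]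
    rw [Nat.cast_pow, rpow_pow_comm]
  -- the small-prime ratio `r₁ = p^{η - 5/6} ≤ 7/10` and bound `h(p^a) ≤ A r₁^a`
  have hr₁ : ∀ {p : ℕ}, p.Prime → (p : ℝ) ^ (η - 5 / 6) ≤ 7 / 10 := by
    intro p hp
    have h2 : (2 : ℝ) ≤ p := by exact_mod_cast hp.two_le
    calc (p : ℝ) ^ (η - 5 / 6) ≤ (2 : ℝ) ^ (η - 5 / 6) :=
          Real.rpow_le_rpow_of_nonpos (by norm_num) h2 (by linarith)
      _ ≤ (2 : ℝ) ^ (-(2 / 3) : ℝ) := Real.rpow_le_rpow_of_exponent_le (by norm_num) (by linarith)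
      _ ≤ 7 / 10 := two_rpow_neg_two_thirds_le
  have hsmall : ∀ {p : ℕ}, p.Prime → ∀ a : ℕ, h (p ^ a) ≤ A * ((p : ℝ) ^ (η - 5 / 6)) ^ a := by
    intro p hp a
    have hp0 : (0 : ℝ) < p := by exact_mod_cast hp.pos
    rw [hpa]
    have h1 : f (p ^ a) ≤ A * ((p : ℝ) ^ (1 / 6 : ℝ)) ^ a := by
      have := hA (p ^ a) (Nat.one_le_iff_ne_zero.2 (pow_ne_zero _ hp.ne_zero))
      rwa [Nat.cast_pow, rpow_pow_comm] at this
    calc f (p ^ a) * ((p : ℝ) ^ (η - 1)) ^ a ≤ A * ((p : ℝ) ^ (1 / 6 : ℝ)) ^ a * ((p : ℝ) ^ (η - 1)) ^ a :=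
          mul_le_mul_of_nonneg_right h1 (by positivity)
      _ = A * ((p : ℝ) ^ (η - 5 / 6)) ^ a := by
          rw [mul_assoc, ← mul_pow, ← Real.rpow_add hp0, show (1 : ℝ) / 6 + (η - 1) = η - 5 / 6 by ring]
  -- summability of the prime-power series
  have hsum : ∀ {p : ℕ}, p.Prime → Summable fun a : ℕ => h (p ^ a) := by
    intro p hp
    have hr0 : 0 ≤ (p : ℝ) ^ (η - 5 / 6) := by positivity
    have hr1 : (p : ℝ) ^ (η - 5 / 6) < 1 := by linarith [hr₁ hp]
    exact Summable.of_nonneg_of_le (fun a => hh0 _) (hsmall hp)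
      ((summable_geometric_of_lt_one hr0 hr1).mul_left A)
  -- Step 1: Euler product
  have h1 := BombieriSieve.sum_le_prod_tsum_of_factored hh1 hhmul hh0 hsum hs hS
  refine h1.trans ?_
  -- Step 2: the factors
  set P₀ : ℕ := ⌈(2 * B) ^ 2⌉₊ with hP₀
  set R : ℕ → ℝ := fun p => (if p < P₀ then 4 * A else 0) + 4 * B ^ 2 * (p : ℝ) ^ (-(5 / 3 : ℝ))
    with hR
  have hfac : ∀ p ∈ s, ∑' a : ℕ, h (p ^ a) ≤ 1 + (f p * (p : ℝ) ^ (η - 1) + R p) := by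
    intro p hps
    have hp := hs p hps
    have hp0 : (0 : ℝ) < p := by exact_mod_cast hp.pos
    have hp1 : (1 : ℝ) ≤ p := by exact_mod_cast hp.one_lt.le
    have hhp : h p = f p * (p : ℝ) ^ (η - 1) := rfl
    by_cases hsm : p < P₀
    · -- small prime: `W = A`, `r = p^{η - 5/6}`
      have := tsum_prime_pow_le (G := h) (p := p) hA0 (by positivity) (hr₁ hp)
        (fun a _ => hsmall hp a) (hsum hp)
      rw [hh1, hhp] at this
      refine this.trans ?_
      simp only [hR, if_pos hsm]
      have e1 : ((p : ℝ) ^ (η - 5 / 6)) ^ 2 ≤ 1 := by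
        refine pow_le_one₀ (by positivity) (Real.rpow_le_one_of_one_le_of_nonpos hp1 (by linarith))
      have e2 : 0 ≤ 4 * B ^ 2 * (p : ℝ) ^ (-(5 / 3 : ℝ)) := by positivity
      nlinarith
    · -- large prime: `W = 1`, `r = B p^{η-1} ≤ 1/2`
      have hpP : (2 * B) ^ 2 ≤ (p : ℝ) := (Nat.ceil_le.1 (not_lt.1 hsm))
      have hB0 : 0 < B := by linarith
      -- `B p^{η - 1} ≤ B p^{-5/6} ≤ 1/2`
      have hr : B * (p : ℝ) ^ (η - 1) ≤ 7 / 10 := by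
        have h56 : (p : ℝ) ^ (η - 1) ≤ (p : ℝ) ^ (-(5 / 6) : ℝ) :=
          Real.rpow_le_rpow_of_exponent_le hp1 (by linarith)
        -- `p^{5/6} ≥ ((2B)^2)^{5/6} ≥ 2B`
        have h2B : (1 : ℝ) ≤ 2 * B := by linarith
        have hp56 : 2 * B ≤ (p : ℝ) ^ (5 / 6 : ℝ) := by
          calc 2 * B = (2 * B) ^ (1 : ℝ) := (Real.rpow_one _).symm
            _ ≤ (2 * B) ^ (2 * (5 / 6) : ℝ) := Real.rpow_le_rpow_of_exponent_le h2B (by norm_num)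
            _ = ((2 * B) ^ 2) ^ (5 / 6 : ℝ) := by
                rw [Real.rpow_mul (by linarith)]; norm_num
            _ ≤ (p : ℝ) ^ (5 / 6 : ℝ) := Real.rpow_le_rpow (by positivity) hpP (by norm_num)
        have hinv : (p : ℝ) ^ (-(5 / 6) : ℝ) = ((p : ℝ) ^ (5 / 6 : ℝ))⁻¹ := Real.rpow_neg hp0.le _
        have h3 : B * (p : ℝ) ^ (-(5 / 6) : ℝ) ≤ 1 / 2 := by
          rw [hinv, ← div_eq_mul_inv, div_le_iff₀ (by positivity)]
          linarith
        calc B * (p : ℝ) ^ (η - 1) ≤ B * (p : ℝ) ^ (-(5 / 6) : ℝ) :=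
              mul_le_mul_of_nonneg_left h56 hB0.le
          _ ≤ 7 / 10 := by linarith
      have hlarge : ∀ a : ℕ, 2 ≤ a → h (p ^ a) ≤ 1 * (B * (p : ℝ) ^ (η - 1)) ^ a := by
        intro a ha
        rw [hpa, one_mul, mul_pow]
        exact mul_le_mul_of_nonneg_right (hB p a hp (by omega)) (by positivity)
      have := tsum_prime_pow_le (G := h) (p := p) zero_le_one (by positivity) hr hlarge (hsum hp)
      rw [hh1, hhp] at this
      refine this.trans ?_
      simp only [hR, if_neg hsm, zero_add]
      have e1 : (B * (p : ℝ) ^ (η - 1)) ^ 2 ≤ B ^ 2 * (p : ℝ) ^ (-(5 / 3 : ℝ)) := by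
        rw [mul_pow, ← Real.rpow_natCast ((p : ℝ) ^ (η - 1)) 2, ← Real.rpow_mul hp0.le]
        refine mul_le_mul_of_nonneg_left (Real.rpow_le_rpow_of_exponent_le hp1 ?_) (by positivity)
        push_cast
        linarith
      nlinarith
  -- Step 3: assemble with `∏ (1 + u_p) ≤ exp(∑ u_p)`
  have hprod := prod_le_exp_sum s (fun p _ => tsum_nonneg fun a => hh0 (p ^ a)) hfac
  refine hprod.trans (Real.exp_le_exp.2 ?_)
  -- `∑_{p ∈ s} R p ≤ K₅`
  have hRsum : ∑ p ∈ s, R p =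
      ∑ p ∈ s, (if p < P₀ then 4 * A else 0) + 4 * B ^ 2 * ∑ p ∈ s, (p : ℝ) ^ (-(5 / 3 : ℝ)) := by
    simp only [hR]
    rw [Finset.sum_add_distrib, Finset.mul_sum]
  have hK : ∑ p ∈ s, R p ≤ K₅ A B := by
    rw [hRsum, K₅]
    refine add_le_add ?_ (mul_le_mul_of_nonneg_left ?_ (by positivity))
    · calc ∑ p ∈ s, (if p < P₀ then 4 * A else (0 : ℝ))
          = ∑ p ∈ s.filter (fun p => p < P₀), 4 * A := by rw [Finset.sum_filter]
        _ = 4 * A * #(s.filter (fun p => p < P₀)) := by rw [Finset.sum_const, nsmul_eq_mul]; ring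
        _ ≤ 4 * A * (P₀ : ℝ) := by
            refine mul_le_mul_of_nonneg_left ?_ (by positivity)
            have : s.filter (fun p => p < P₀) ⊆ Finset.range P₀ := fun p hp => by
              rw [Finset.mem_range]; exact (Finset.mem_filter.1 hp).2
            exact_mod_cast (Finset.card_le_card this).trans_eq (Finset.card_range P₀)
    · exact Summable.sum_le_tsum s (fun m _ => by positivity) summable_rpow_neg_five_thirds
  have hsplit : ∑ p ∈ s, (f p * (p : ℝ) ^ (η - 1) + R p) =
      ∑ p ∈ s, f p * (p : ℝ) ^ (η - 1) + ∑ p ∈ s, R p := Finset.sum_add_distrib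
  calc ∑ p ∈ s, (f p * (p : ℝ) ^ (η - 1) + R p)
      = ∑ p ∈ s, f p * (p : ℝ) ^ (η - 1) + ∑ p ∈ s, R p := hsplit
    _ ≤ ∑ p ∈ s, f p * (p : ℝ) ^ (η - 1) + K₅ A B := by linarith

/-! ### The Mertens step and Rankin's trick with a uniform exponent -/

/-- `p^η - 1 ≤ η log p · v^η` for `1 ≤ p ≤ v`, `η ≥ 0` (from `e^t - 1 ≤ t e^t`). [folklore] -/
theorem rpow_sub_one_le_mul {p v η : ℝ} (hp : 1 ≤ p) (hpv : p ≤ v) (hη : 0 ≤ η) :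
    p ^ η - 1 ≤ η * Real.log p * v ^ η := by
  have hp0 : 0 < p := by linarith
  have hlogp : 0 ≤ Real.log p := Real.log_nonneg hp
  rw [Real.rpow_def_of_pos hp0]
  -- `e^t - 1 ≤ t e^t` for `t = log p · η`
  have h1 : Real.exp (Real.log p * η) - 1 ≤ Real.log p * η * Real.exp (Real.log p * η) := by
    set t := Real.log p * η with ht
    have h := Real.add_one_le_exp (-t)
    rw [Real.exp_neg] at h
    have hpos := Real.exp_pos t
    have h2 : (-t + 1) * Real.exp t ≤ 1 := by
      calc (-t + 1) * Real.exp t ≤ (Real.exp t)⁻¹ * Real.exp t :=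
            mul_le_mul_of_nonneg_right h hpos.le
        _ = 1 := inv_mul_cancel₀ hpos.ne'
    nlinarith
  have h2 : Real.exp (Real.log p * η) ≤ v ^ η := by
    rw [← Real.rpow_def_of_pos hp0]
    exact Real.rpow_le_rpow hp0.le hpv hη
  calc Real.exp (Real.log p * η) - 1 ≤ Real.log p * η * Real.exp (Real.log p * η) := h1
    _ ≤ Real.log p * η * v ^ η := mul_le_mul_of_nonneg_left h2 (mul_nonneg hlogp hη)
    _ = η * Real.log p * v ^ η := by ring

/-- **The Mertens step**: for a finite set `s` of primes `≤ v` (`v ≥ 1`), `f(p) ≤ B` on `s` (`B ≥ 0`) and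
`η ≥ 0`, `∑_{p∈s} f(p) p^{η-1} ≤ ∑_{p∈s} f(p)/p + B η v^η (log v + log 4)`
(via `p^η ≤ 1 + η log p · v^η` and Mertens' `∑_{p ≤ v} log p / p ≤ log v + log 4`).
[cite: Shiu1980, §3 (proof of Lemma 3: the passage from δ to 1)] -/
theorem sum_rpow_le_sum_div_add {f : ℕ → ℝ} {s : Finset ℕ} (hs : ∀ p ∈ s, p.Prime) {v : ℝ}
    (hv : 1 ≤ v) (hsv : ∀ p ∈ s, (p : ℝ) ≤ v) {B : ℝ} (hB0 : 0 ≤ B)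
    (hfB : ∀ p ∈ s, f p ≤ B) {η : ℝ} (hη : 0 ≤ η) :
    ∑ p ∈ s, f p * (p : ℝ) ^ (η - 1) ≤
      ∑ p ∈ s, f p / p + B * η * v ^ η * (Real.log v + Real.log 4) := by
  have hv0 : 0 < v := by linarith
  -- pointwise
  have hpt : ∀ p ∈ s, f p * (p : ℝ) ^ (η - 1) ≤ f p / p + B * η * v ^ η * (Real.log p / p) := by
    intro p hp
    have hpp := hs p hp
    have hp0 : (0 : ℝ) < p := by exact_mod_cast hpp.pos
    have hp1 : (1 : ℝ) ≤ p := by exact_mod_cast hpp.one_lt.le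
    have h1 := rpow_sub_one_le_mul hp1 (hsv p hp) hη
    rw [Real.rpow_sub hp0, Real.rpow_one]
    have h2 : f p * ((p : ℝ) ^ η / p) = f p / p + f p * (((p : ℝ) ^ η - 1) / p) := by ring
    rw [h2]
    refine add_le_add le_rfl ?_
    calc f p * (((p : ℝ) ^ η - 1) / p) ≤ B * ((η * Real.log p * v ^ η) / p) := by
          refine mul_le_mul (hfB p hp) (div_le_div_of_nonneg_right h1 hp0.le) ?_ hB0
          refine div_nonneg ?_ hp0.le
          rw [sub_nonneg]
          exact Real.one_le_rpow hp1 hη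
      _ = B * η * v ^ η * (Real.log p / p) := by ring
  refine (Finset.sum_le_sum hpt).trans ?_
  rw [Finset.sum_add_distrib, ← Finset.mul_sum]
  refine add_le_add le_rfl (mul_le_mul_of_nonneg_left ?_ (by positivity))
  -- Mertens
  have hsub : s ⊆ Nat.primesLE ⌊v⌋₊ := fun p hp =>
    Nat.mem_primesLE.2 ⟨Nat.le_floor (hsv p hp), hs p hp⟩
  have hfl1 : 1 ≤ ⌊v⌋₊ := Nat.le_floor (by simpa using hv)
  have hfl0 : (0 : ℝ) < ⌊v⌋₊ := by exact_mod_cast hfl1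
  calc ∑ p ∈ s, Real.log p / p ≤ ∑ p ∈ Nat.primesLE ⌊v⌋₊, Real.log p / p :=
        Finset.sum_le_sum_of_subset_of_nonneg hsub fun p hp _ => by
          have := (Nat.mem_primesLE.1 hp).2
          exact div_nonneg (Real.log_nonneg (by exact_mod_cast this.one_lt.le)) (Nat.cast_nonneg p)
    _ ≤ Real.log (⌊v⌋₊ : ℝ) + Real.log 4 := LFunctions.MertensBound.sum_log_div_prime_le ⌊v⌋₊
    _ ≤ Real.log v + Real.log 4 := by
        have := Real.log_le_log hfl0 (Nat.floor_le hv0.le)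
        linarith

/-- The sifting set of primes below `v` not dividing `k`. [folklore] -/
def primesBelowNotDvd (v : ℝ) (k : ℕ) : Finset ℕ :=
  (Nat.primesBelow ⌈v⌉₊).filter fun p => ¬ p ∣ k

/-- Membership in `primesBelowNotDvd v k`: `p` prime, `p < v`, `p ∤ k`. [folklore] -/
theorem mem_primesBelowNotDvd {v : ℝ} {k p : ℕ} :
    p ∈ primesBelowNotDvd v k ↔ p.Prime ∧ (p : ℝ) < v ∧ ¬ p ∣ k := by
  rw [primesBelowNotDvd, Finset.mem_filter, Nat.mem_primesBelow, Nat.lt_ceil]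
  tauto

/-- **Rankin's trick with a uniform exponent** (Shiu 1980, Lemma 3, in a linearised form): let
`f ≥ 0` be multiplicative on coprime arguments with `f 1 = 1`, `f(p^l) ≤ B^l` (`B ≥ 1`),
`f(n) ≤ A n^{1/6}`; let `k ≥ 1`, `v ≥ 2`, `w > 0`, `0 ≤ η ≤ 1/6`, and let `S` be a finite set of
positive integers `c ≥ w`, prime to `k`, all of whose prime factors are `< v`.  Then
`∑_{c ∈ S} f(c)/c ≤ w^{-η} · exp(∑_{p < v, p ∤ k} f(p)/p + B η v^η (log v + log 4) + K₅(A,B))`.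
[cite: Shiu1980, Lemma 3] -/
theorem rankin_tail {f : ℕ → ℝ} (hf0 : ∀ n, 0 ≤ f n) (hf1 : f 1 = 1)
    (hmul : ∀ m n : ℕ, m.Coprime n → f (m * n) = f m * f n)
    {B : ℝ} (hB1 : 1 ≤ B) (hB : ∀ p l : ℕ, p.Prime → 1 ≤ l → f (p ^ l) ≤ B ^ l)
    {A : ℝ} (hA : ∀ n : ℕ, 1 ≤ n → f n ≤ A * (n : ℝ) ^ (1 / 6 : ℝ))
    {η : ℝ} (hη0 : 0 ≤ η) (hη : η ≤ 1 / 6) {v w : ℝ} (hv : 2 ≤ v) (hw : 0 < w) (k : ℕ)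
    {S : Finset ℕ} (hS0 : ∀ c ∈ S, c ≠ 0) (hSw : ∀ c ∈ S, w ≤ (c : ℝ))
    (hSk : ∀ c ∈ S, c.Coprime k) (hSv : ∀ c ∈ S, ∀ p ∈ c.primeFactors, (p : ℝ) < v) :
    ∑ c ∈ S, f c / c ≤ w ^ (-η) * Real.exp (∑ p ∈ primesBelowNotDvd v k, f p / p +
      B * η * v ^ η * (Real.log v + Real.log 4) + K₅ A B) := by
  set s := primesBelowNotDvd v k with hs_def
  have hs : ∀ p ∈ s, p.Prime := fun p hp => (mem_primesBelowNotDvd.1 hp).1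
  -- Step 1: `f(c)/c ≤ w^{-η} f(c) c^{η-1}`
  have h1 : ∀ c ∈ S, f c / c ≤ w ^ (-η) * (f c * (c : ℝ) ^ (η - 1)) := by
    intro c hc
    have hc0 : (0 : ℝ) < c := by exact_mod_cast Nat.pos_of_ne_zero (hS0 c hc)
    have heq : f c / c = (c : ℝ) ^ (-η) * (f c * (c : ℝ) ^ (η - 1)) := by
      rw [div_eq_mul_inv, ← Real.rpow_neg_one, show (-1 : ℝ) = -η + (η - 1) by ring,
        Real.rpow_add hc0]
      ring
    rw [heq]
    exact mul_le_mul_of_nonneg_right (Real.rpow_le_rpow_of_nonpos hw (hSw c hc) (by linarith))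
      (mul_nonneg (hf0 c) (by positivity))
  -- Step 2: the Euler majorant
  have hfact : ∀ c ∈ S, c ∈ Nat.factoredNumbers s := by
    intro c hc
    rw [Nat.mem_factoredNumbers']
    intro p hp hpc
    rw [hs_def, mem_primesBelowNotDvd]
    refine ⟨hp, hSv c hc p (Nat.mem_primeFactors.2 ⟨hp, hpc, hS0 c hc⟩), fun hpk => ?_⟩
    have h := Nat.dvd_gcd hpc hpk
    rw [(hSk c hc).gcd_eq_one] at h
    exact hp.one_lt.ne' (Nat.dvd_one.1 h)
  have h2 := euler_majorant hf0 hf1 hmul hB1 hB hA hη hs hfact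
  -- Step 3: the Mertens step
  have hv1 : 1 ≤ v := by linarith
  have h3 := sum_rpow_le_sum_div_add (f := f) hs hv1
    (fun p hp => (mem_primesBelowNotDvd.1 hp).2.1.le) (by linarith : (0 : ℝ) ≤ B)
    (fun p hp => by
      have := hB p 1 (hs p hp) le_rfl
      rwa [pow_one, pow_one] at this) hη0
  calc ∑ c ∈ S, f c / c ≤ ∑ c ∈ S, w ^ (-η) * (f c * (c : ℝ) ^ (η - 1)) := Finset.sum_le_sum h1
    _ = w ^ (-η) * ∑ c ∈ S, f c * (c : ℝ) ^ (η - 1) := by rw [Finset.mul_sum]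
    _ ≤ w ^ (-η) * Real.exp (∑ p ∈ s, f p * (p : ℝ) ^ (η - 1) + K₅ A B) :=
        mul_le_mul_of_nonneg_left h2 (by positivity)
    _ ≤ _ := by
        refine mul_le_mul_of_nonneg_left (Real.exp_le_exp.2 ?_) (by positivity)
        linarith

/-! ### Counting in a segment of a progression -/

/-- A reduced multiplier can be inverted: for `(c, k) = 1`, `k ≠ 0`, there is `b` with
`c d ≡ a (mod k) ↔ d ≡ b (mod k)`. [folklore] -/
theorem exists_residue_of_coprime {c k : ℕ} (hck : c.Coprime k) (hk : k ≠ 0) (a : ℕ) :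
    ∃ b : ℕ, ∀ d : ℕ, c * d ≡ a [MOD k] ↔ d ≡ b [MOD k] := by
  obtain ⟨b, -, hb⟩ := Nat.exists_mul_mod_eq_of_coprime a hck hk
  refine ⟨b, fun d => ⟨fun h => ?_, fun h => ?_⟩⟩
  · have h1 : c * d ≡ c * b [MOD k] := h.trans (show a ≡ c * b [MOD k] from hb.symm)
    exact Nat.ModEq.cancel_left_of_coprime (by rwa [Nat.coprime_comm] at hck) h1
  · exact (Nat.ModEq.mul_left c h).trans hb

/-- The length of the segment `(⌊x/c⌋, ⌊(x+y)/c⌋]` is at most `y/c + 1`. [folklore] -/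
theorem floor_sub_floor_le {x y c : ℝ} (hx : 0 ≤ x) (hy : 0 ≤ y) (hc : 0 < c) :
    ((⌊(x + y) / c⌋₊ : ℕ) : ℝ) - ((⌊x / c⌋₊ : ℕ) : ℝ) ≤ y / c + 1 := by
  have h1 : ((⌊(x + y) / c⌋₊ : ℕ) : ℝ) ≤ (x + y) / c := Nat.floor_le (by positivity)
  have h2 : x / c - 1 < ((⌊x / c⌋₊ : ℕ) : ℝ) := Nat.sub_one_lt_floor _
  have h3 : (x + y) / c = x / c + y / c := add_div _ _ _
  linarith

/-- `⌊x/c⌋ ≤ ⌊(x+y)/c⌋` for `y ≥ 0`, `c > 0`. [folklore] -/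
theorem floor_le_floor_div {x y c : ℝ} (hy : 0 ≤ y) (hc : 0 < c) :
    ⌊x / c⌋₊ ≤ ⌊(x + y) / c⌋₊ :=
  Nat.floor_le_floor (div_le_div_of_nonneg_right (by linarith) hc.le)

/-- **A class in a segment**: `#{X₁ < d ≤ X₂ : d ≡ b (mod k)} ≤ (X₂ - X₁)/k + 1`. [folklore] -/
theorem card_segment_modEq_le {k : ℕ} (hk : 0 < k) (b : ℕ) {X₁ X₂ : ℕ} (h : X₁ ≤ X₂) :
    (#((Ioc X₁ X₂).filter fun d : ℕ => d ≡ b [MOD k]) : ℝ) ≤ ((X₂ : ℝ) - X₁) / k + 1 := by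
  have := BFI.abs_card_Ioc_filter_modEq_sub_le hk b h
  rw [abs_le] at this
  linarith [this.2]

/-- **Multiples in a segment of a reduced progression**: for `(m, k) = 1`, `m, k ≥ 1`,
`#{X₁ < n ≤ X₂ : n ≡ a (mod k), m ∣ n} ≤ (X₂ - X₁)/(k m) + 1`. [folklore] -/
theorem card_segment_modEq_dvd_le {k m : ℕ} (hk : 0 < k) (hm : 0 < m) (hkm : k.Coprime m) (a : ℕ)
    {X₁ X₂ : ℕ} (h : X₁ ≤ X₂) :
    (#((Ioc X₁ X₂).filter fun n : ℕ => n ≡ a [MOD k] ∧ m ∣ n) : ℝ) ≤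
      ((X₂ : ℝ) - X₁) / ((k : ℝ) * m) + 1 := by
  rw [BFI.filter_modEq_and_dvd_eq hkm a]
  have := card_segment_modEq_le (Nat.mul_pos hk hm) (Nat.chineseRemainder hkm a 0 : ℕ) h
  push_cast at this
  exact this

/-- The Mertens factor of the sifted progression:
`(∏_{p < u, p ∤ k} (1 - 1/p)) · φ(k)/k ≤ ∏_{p<u}(1 - 1/p) ≤ 1/log u` (`u > 1`, `k ≥ 1`). [folklore] -/
theorem sieveDensity_primesBelowNotDvd_le {u : ℝ} (hu : 1 < u) {k : ℕ} (hk : 0 < k) :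
    MaierMatrix.sieveDensity (primesBelowNotDvd u k) ≤ ((k : ℝ) / Nat.totient k) / Real.log u := by
  have hφ0 : (0 : ℝ) < Nat.totient k := by exact_mod_cast Nat.totient_pos.2 hk
  have hk0 : (0 : ℝ) < k := by exact_mod_cast hk
  set T := Nat.primesBelow ⌈u⌉₊ with hT
  have hfac : ∀ p : ℕ, p.Prime → 0 ≤ 1 - (p : ℝ)⁻¹ ∧ 1 - (p : ℝ)⁻¹ ≤ 1 := by
    intro p hp
    refine ⟨sub_nonneg.2 (inv_le_one_of_one_le₀ (by exact_mod_cast hp.one_lt.le)), ?_⟩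
    exact sub_le_self _ (inv_nonneg.2 (Nat.cast_nonneg p))
  have hV : MaierMatrix.sieveDensity (primesBelowNotDvd u k) =
      ∏ p ∈ T.filter (fun p : ℕ => ¬ p ∣ k), (1 - (p : ℝ)⁻¹) := rfl
  have hsplit : ∏ p ∈ T, (1 - (p : ℝ)⁻¹) =
      (∏ p ∈ T.filter (fun p : ℕ => ¬ p ∣ k), (1 - (p : ℝ)⁻¹)) *
        ∏ p ∈ T.filter (fun p : ℕ => p ∣ k), (1 - (p : ℝ)⁻¹) := by
    rw [mul_comm, Finset.prod_filter_mul_prod_filter_not]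
  have hsub : T.filter (fun p : ℕ => p ∣ k) ⊆ k.primeFactors := by
    intro p hp
    obtain ⟨hp, hpk⟩ := Finset.mem_filter.1 hp
    exact Nat.mem_primeFactors.2 ⟨Nat.prime_of_mem_primesBelow hp, hpk, hk.ne'⟩
  have hmono : ∏ p ∈ k.primeFactors, (1 - (p : ℝ)⁻¹) ≤
      ∏ p ∈ T.filter (fun p : ℕ => p ∣ k), (1 - (p : ℝ)⁻¹) :=
    Finset.prod_le_prod_of_subset_of_le_one hsub
      (fun p hp => (hfac p (Nat.prime_of_mem_primeFactors hp)).1)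
      (fun p hp _ => (hfac p (Nat.prime_of_mem_primeFactors hp)).2)
  have hφ : ∏ p ∈ k.primeFactors, (1 - (p : ℝ)⁻¹) = (Nat.totient k : ℝ) / k := by
    rw [LFunctions.MertensBound.totient_eq_mul_prod_one_sub_inv, mul_div_cancel_left₀ _ hk0.ne']
    simp only [one_div]
  have hM : ∏ p ∈ T, (1 - (p : ℝ)⁻¹) ≤ 1 / Real.log u :=
    BombieriSieve.prod_primesBelow_one_sub_inv_le hu
  have hVnn : 0 ≤ ∏ p ∈ T.filter (fun p : ℕ => ¬ p ∣ k), (1 - (p : ℝ)⁻¹) :=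
    Finset.prod_nonneg fun p hp => (hfac p (Nat.prime_of_mem_primesBelow (Finset.mem_filter.1 hp).1)).1
  have key : (∏ p ∈ T.filter (fun p : ℕ => ¬ p ∣ k), (1 - (p : ℝ)⁻¹)) * ((Nat.totient k : ℝ) / k) ≤
      1 / Real.log u := by
    calc (∏ p ∈ T.filter (fun p : ℕ => ¬ p ∣ k), (1 - (p : ℝ)⁻¹)) * ((Nat.totient k : ℝ) / k)
        = (∏ p ∈ T.filter (fun p : ℕ => ¬ p ∣ k), (1 - (p : ℝ)⁻¹)) *
            ∏ p ∈ k.primeFactors, (1 - (p : ℝ)⁻¹) := by rw [hφ]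
      _ ≤ (∏ p ∈ T.filter (fun p : ℕ => ¬ p ∣ k), (1 - (p : ℝ)⁻¹)) *
            ∏ p ∈ T.filter (fun p : ℕ => p ∣ k), (1 - (p : ℝ)⁻¹) :=
          mul_le_mul_of_nonneg_left hmono hVnn
      _ = ∏ p ∈ T, (1 - (p : ℝ)⁻¹) := hsplit.symm
      _ ≤ 1 / Real.log u := hM
  rw [hV]
  have hφk : (0 : ℝ) < (Nat.totient k : ℝ) / k := by positivity
  rw [← le_div_iff₀ hφk] at key
  refine key.trans (le_of_eq ?_)
  field_simp

/-- **The sifted segment of a progression** (Shiu 1980, Lemma 2 = the Brun–Titchmarsh-type bound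
`Φ(x, y, z; k, a) ≪ y/(φ(k) log z) + z²`, here from the tree's Fundamental Lemma for a segment,
`ShiftedWindowSieve.abs_apSiftedCount_sub_le`, with level `D = u`): there is an absolute `C₁ > 0`
with `#{X₁ < d ≤ X₂ : d ≡ b (mod k), p ∤ d for all primes p < u} ≤ C₁ (X₂ - X₁)/(φ(k) log u) + u`
for all `k ≥ 1`, `b`, `X₁ ≤ X₂`, `u ≥ 2` (the primes `p < u` are `Nat.primesBelow ⌈u⌉₊`).
[cite: Shiu1980, Lemma 2] -/
theorem segment_sieve_bound :
    ∃ C₁ : ℝ, 0 < C₁ ∧ ∀ (k : ℕ), 0 < k → ∀ (b X₁ X₂ : ℕ), X₁ ≤ X₂ → ∀ (u : ℝ), 2 ≤ u →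
      (#((Ioc X₁ X₂).filter fun d : ℕ =>
          d ≡ b [MOD k] ∧ ∀ p ∈ Nat.primesBelow ⌈u⌉₊, ¬ p ∣ d) : ℝ) ≤
        C₁ * (((X₂ : ℝ) - X₁) / ((Nat.totient k : ℝ) * Real.log u)) + u := by
  obtain ⟨C, hC, h⟩ := ShiftedWindowSieve.abs_apSiftedCount_sub_le
  refine ⟨1 + C, by linarith, fun k hk b X₁ X₂ hX u hu => ?_⟩
  set Ps := primesBelowNotDvd u k with hPs
  have hPs1 : ∀ p ∈ Ps, p.Prime := fun p hp => (mem_primesBelowNotDvd.1 hp).1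
  have hPs2 : ∀ p ∈ Ps, (p : ℝ) < u := fun p hp => (mem_primesBelowNotDvd.1 hp).2.1
  have hPs3 : ∀ p ∈ Ps, ¬ p ∣ k := fun p hp => (mem_primesBelowNotDvd.1 hp).2.2
  have h1 := h Ps u hPs1 hPs2 k hk hPs3 X₁ (X₂ - X₁) b u hu le_rfl
  -- our set is inside the sifted segment
  have hsub : (#((Ioc X₁ X₂).filter fun d : ℕ =>
      d ≡ b [MOD k] ∧ ∀ p ∈ Nat.primesBelow ⌈u⌉₊, ¬ p ∣ d) : ℝ) ≤
      ShiftedWindowSieve.apSiftedCount X₁ (X₂ - X₁) k b Ps := by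
    rw [ShiftedWindowSieve.apSiftedCount, Nat.add_sub_cancel' hX]
    exact_mod_cast Finset.card_le_card fun d hd => by
      rw [Finset.mem_filter] at hd ⊢
      exact ⟨hd.1, hd.2.1, fun p hp => hd.2.2 p (Finset.mem_filter.1 hp).1⟩
  refine hsub.trans ?_
  rw [abs_le] at h1
  have hV := sieveDensity_primesBelowNotDvd_le (by linarith : (1 : ℝ) < u) hk
  obtain ⟨hV0, -⟩ := MaierMatrix.sieveDensity_nonneg_le_one Ps
  have hlogu : 0 < Real.log u := Real.log_pos (by linarith)
  have hφ0 : (0 : ℝ) < Nat.totient k := by exact_mod_cast Nat.totient_pos.2 hk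
  have hk0 : (0 : ℝ) < k := by exact_mod_cast hk
  have hy0 : (0 : ℝ) ≤ ((X₂ - X₁ : ℕ) : ℝ) := Nat.cast_nonneg _
  have hexp : Real.exp (-(Real.log u / Real.log u)) ≤ 1 := by
    rw [div_self hlogu.ne']
    exact Real.exp_le_one_iff.2 (by norm_num)
  -- `count ≤ (1 + C) (y/k) V + u`
  have h2 : (ShiftedWindowSieve.apSiftedCount X₁ (X₂ - X₁) k b Ps : ℝ) ≤
      (1 + C) * (((X₂ - X₁ : ℕ) : ℝ) / k * MaierMatrix.sieveDensity Ps) + u := by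
    have hm : 0 ≤ ((X₂ - X₁ : ℕ) : ℝ) / k * MaierMatrix.sieveDensity Ps := by positivity
    have h3 : C * (((X₂ - X₁ : ℕ) : ℝ) / k) * MaierMatrix.sieveDensity Ps *
        Real.exp (-(Real.log u / Real.log u)) ≤ C * (((X₂ - X₁ : ℕ) : ℝ) / k * MaierMatrix.sieveDensity Ps) := by
      rw [mul_assoc C]
      exact (mul_le_mul_of_nonneg_left hexp (by positivity)).trans (le_of_eq (mul_one _))
    linarith [h1.2]
  have hcast : ((X₂ - X₁ : ℕ) : ℝ) = (X₂ : ℝ) - X₁ := by push_cast [Nat.cast_sub hX]; ring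
  rw [hcast] at h2
  have hmain : ((X₂ : ℝ) - X₁) / k * MaierMatrix.sieveDensity Ps ≤
      ((X₂ : ℝ) - X₁) / ((Nat.totient k : ℝ) * Real.log u) := by
    calc ((X₂ : ℝ) - X₁) / k * MaierMatrix.sieveDensity Ps
        ≤ ((X₂ : ℝ) - X₁) / k * (((k : ℝ) / Nat.totient k) / Real.log u) :=
          mul_le_mul_of_nonneg_left hV (div_nonneg (by rw [← hcast]; exact hy0) hk0.le)
      _ = ((X₂ : ℝ) - X₁) / ((Nat.totient k : ℝ) * Real.log u) := by
          field_simp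
  have hC1 : (0 : ℝ) ≤ 1 + C := by linarith
  have := mul_le_mul_of_nonneg_left hmain hC1
  linarith

/-! ### The main set and its fibres -/

/-- The set summed over: `{⌊x⌋ < n ≤ ⌊x + y⌋ : n ≡ a (mod k)} = {x < n ≤ x + y : n ≡ a (mod k)}`. [folklore] -/
def mainSet (x y : ℝ) (k a : ℕ) : Finset ℕ :=
  (Ioc ⌊x⌋₊ ⌊x + y⌋₊).filter fun n : ℕ => n ≡ a [MOD k]

/-- The segment of cofactors: `{⌊x/c⌋ < d ≤ ⌊(x+y)/c⌋}`. [folklore] -/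
def segSet (x y : ℝ) (c : ℕ) : Finset ℕ := Ioc ⌊x / c⌋₊ ⌊(x + y) / c⌋₊

variable {x y : ℝ} {k a : ℕ}

/-- Membership in the main set. [folklore] -/
theorem mem_mainSet {n : ℕ} : n ∈ mainSet x y k a ↔ ⌊x⌋₊ < n ∧ n ≤ ⌊x + y⌋₊ ∧ n ≡ a [MOD k] := by
  rw [mainSet, Finset.mem_filter, Finset.mem_Ioc, and_assoc]

/-- Basic facts on the elements of the main set (`x ≥ 1`, `y ≥ 0`). [folklore] -/
theorem mainSet_props (hx : 1 ≤ x) (hy : 0 ≤ y) {n : ℕ} (hn : n ∈ mainSet x y k a) :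
    x < n ∧ (n : ℝ) ≤ x + y ∧ 2 ≤ n ∧ n ≡ a [MOD k] := by
  obtain ⟨h1, h2, h3⟩ := mem_mainSet.1 hn
  have hx0 : 0 ≤ x := by linarith
  have hxn : x < n := (Nat.floor_lt hx0).1 h1
  refine ⟨hxn, ?_, ?_, h3⟩
  · exact (Nat.le_floor_iff (by linarith)).1 h2
  · have : (1 : ℝ) < n := lt_of_le_of_lt hx hxn
    exact_mod_cast this

/-- Elements of the main set are prime to the modulus when `(a, k) = 1`. [folklore] -/
theorem coprime_of_mem_mainSet (hak : a.Coprime k) {n : ℕ} (hn : n ∈ mainSet x y k a) :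
    n.Coprime k := by
  have h := (mem_mainSet.1 hn).2.2
  show Nat.gcd n k = 1
  rw [h.gcd_eq]
  exact hak

/-- A divisor `c` of an element `n` of the main set puts `n / c` in the segment `segSet x y c`. [folklore] -/
theorem div_mem_segSet (hx : 1 ≤ x) (hy : 0 ≤ y) {n : ℕ} (hn : n ∈ mainSet x y k a) {c : ℕ}
    (hc : c ≠ 0) (hcn : c ∣ n) : n / c ∈ segSet x y c := by
  obtain ⟨hxn, hnxy, -, -⟩ := mainSet_props hx hy hn
  have hc0 : (0 : ℝ) < c := by exact_mod_cast Nat.pos_of_ne_zero hc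
  have hcast : ((n / c : ℕ) : ℝ) = (n : ℝ) / c := Nat.cast_div hcn hc0.ne'
  rw [segSet, Finset.mem_Ioc]
  constructor
  · rw [Nat.floor_lt (by positivity), hcast]
    exact div_lt_div_of_pos_right hxn hc0
  · rw [Nat.le_floor_iff (by positivity), hcast]
    exact div_le_div_of_nonneg_right hnxy hc0.le

/-- Fibre counting: if `c ∣ n` for all `n ∈ T` and `n / c ∈ D`, then `#T ≤ #D`. [folklore] -/
theorem card_le_card_of_div {T D : Finset ℕ} {c : ℕ} (hTc : ∀ n ∈ T, c ∣ n)
    (himg : ∀ n ∈ T, n / c ∈ D) : #T ≤ #D := by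
  refine Finset.card_le_card_of_injOn (fun n => n / c) himg fun n hn m hm h => ?_
  exact (Nat.div_left_inj (hTc n hn) (hTc m hm)).1 h

/-- The length of `segSet x y c` is at most `y / c + 1`, and it is a genuine segment. [folklore] -/
theorem segSet_length_le (hx : 1 ≤ x) (hy : 0 ≤ y) {c : ℕ} (hc : c ≠ 0) :
    ⌊x / c⌋₊ ≤ ⌊(x + y) / c⌋₊ ∧
      ((⌊(x + y) / (c : ℝ)⌋₊ : ℕ) : ℝ) - ((⌊x / (c : ℝ)⌋₊ : ℕ) : ℝ) ≤ y / c + 1 := by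
  have hc0 : (0 : ℝ) < c := by exact_mod_cast Nat.pos_of_ne_zero hc
  exact ⟨floor_le_floor_div hy hc0, floor_sub_floor_le (by linarith) hy hc0⟩

/-! ### Class I: the cofactor has only large prime factors -/

/-- **Class I** (Shiu 1980, §5, the sum `∑_I`): the `n` whose cut prime exceeds `w`.  Writing
`n = c d` with `c = c_n ≤ z`, `(c, k) = 1` and `d` free of prime factors `≤ w`, one has
`f(d) ≤ B^{Ω(d)} ≤ B^M` (`Ω(d) ≤ log 2x / log w ≤ M`), the `d` are counted by the sifted-segment
bound, and `∑_{c ≤ z, (c,k)=1} f(c)/c ≤ e^{K₅} exp(∑_{p ≤ z, p ∤ k} f(p)/p)`. [cite: Shiu1980, §5 (∑_I)] -/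
theorem classI_bound {f : ℕ → ℝ} (hf0 : ∀ n, 0 ≤ f n) (hf1 : f 1 = 1)
    (hmul : ∀ m n : ℕ, m.Coprime n → f (m * n) = f m * f n)
    {B : ℝ} (hB1 : 1 ≤ B) (hB : ∀ p l : ℕ, p.Prime → 1 ≤ l → f (p ^ l) ≤ B ^ l)
    {A : ℝ} (hA : ∀ n : ℕ, 1 ≤ n → f n ≤ A * (n : ℝ) ^ (1 / 6 : ℝ))
    {x y z w : ℝ} (hx : 1 ≤ x) (hy : 0 < y) (hyx : y ≤ x) (hz1 : 1 ≤ z) (hzx : z ≤ x) (hw : 2 ≤ w)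
    {k a : ℕ} (hk : 0 < k) (hak : a.Coprime k)
    {M : ℕ} (hM : Real.log (2 * x) / Real.log w ≤ M) {C₁ : ℝ} (hC₁ : 0 < C₁)
    (hsieve : ∀ (b X₁ X₂ : ℕ), X₁ ≤ X₂ → ∀ (u : ℝ), 2 ≤ u →
      (#((Ioc X₁ X₂).filter fun d : ℕ => d ≡ b [MOD k] ∧ ∀ p ∈ Nat.primesBelow ⌈u⌉₊, ¬ p ∣ d) : ℝ) ≤
        C₁ * (((X₂ : ℝ) - X₁) / ((Nat.totient k : ℝ) * Real.log u)) + u) :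
    ∑ n ∈ (mainSet x y k a).filter (fun n => w < (cutPrime z n : ℝ)), f n ≤
      B ^ M * (C₁ * (y + z) / ((Nat.totient k : ℝ) * Real.log w) + w * z) *
        Real.exp (∑ p ∈ primesBelowNotDvd ((⌊z⌋₊ : ℝ) + 1) k, f p / p + K₅ A B) := by
  set T := (mainSet x y k a).filter (fun n => w < (cutPrime z n : ℝ)) with hT
  set Cz := (Icc 1 ⌊z⌋₊).filter (fun c : ℕ => c.Coprime k) with hCz
  have hφ : (0 : ℝ) < Nat.totient k := by exact_mod_cast Nat.totient_pos.2 hk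
  have hlogw : 0 < Real.log w := Real.log_pos (by linarith)
  have hBM : (0 : ℝ) ≤ B ^ M := by positivity
  have hy0 : 0 ≤ y := hy.le
  -- facts about `n ∈ T`
  have hTmem : ∀ n ∈ T, n ∈ mainSet x y k a ∧ w < (cutPrime z n : ℝ) := fun n hn =>
    Finset.mem_filter.1 hn
  have hn2 : ∀ n ∈ T, 2 ≤ n := fun n hn => (mainSet_props hx hy0 (hTmem n hn).1).2.2.1
  have hzn : ∀ n ∈ T, z < n := fun n hn => lt_of_le_of_lt hzx (mainSet_props hx hy0 (hTmem n hn).1).1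
  -- the fibre map
  have hmaps : ∀ n ∈ T, cPart z n ∈ Cz := by
    intro n hn
    have hn0 : n ≠ 0 := by have := hn2 n hn; omega
    rw [hCz, Finset.mem_filter, Finset.mem_Icc]
    refine ⟨⟨Nat.one_le_iff_ne_zero.2 cPart_ne_zero, Nat.le_floor (cutPrime_mem (hn2 n hn) hz1).2⟩, ?_⟩
    exact Nat.Coprime.coprime_dvd_left (cPart_dvd hn0) (coprime_of_mem_mainSet hak (hTmem n hn).1)
  rw [← Finset.sum_fiberwise_of_maps_to hmaps]
  -- the inner sums
  have hinner : ∀ c ∈ Cz, ∑ n ∈ T.filter (fun n => cPart z n = c), f n ≤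
      f c * B ^ M * (C₁ * ((y / c + 1) / ((Nat.totient k : ℝ) * Real.log w)) + w) := by
    intro c hc
    rw [hCz, Finset.mem_filter, Finset.mem_Icc] at hc
    obtain ⟨⟨hc1, hcz⟩, hck⟩ := hc
    have hc0 : c ≠ 0 := by omega
    have hc0' : (0 : ℝ) < c := by exact_mod_cast hc1
    obtain ⟨b, hb⟩ := exists_residue_of_coprime hck hk.ne' a
    set Tc := T.filter (fun n => cPart z n = c) with hTc
    set Dc := (segSet x y c).filter (fun d : ℕ =>
      d ≡ b [MOD k] ∧ ∀ p ∈ Nat.primesBelow ⌈w⌉₊, ¬ p ∣ d) with hDc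
    have hTc_mem : ∀ n ∈ Tc, n ∈ T ∧ cPart z n = c := fun n hn => Finset.mem_filter.1 hn
    -- pointwise bound
    have hpt : ∀ n ∈ Tc, f n ≤ f c * B ^ M := by
      intro n hn
      obtain ⟨hnT, hcn⟩ := hTc_mem n hn
      have h2 := hn2 n hnT
      have hn0 : n ≠ 0 := by omega
      obtain ⟨hxn, hnxy, -, -⟩ := mainSet_props hx hy0 (hTmem n hnT).1
      have hsplit : f n = f c * f (dPart z n) := by
        conv_lhs => rw [← cPart_mul_dPart (z := z) hn0]
        rw [hmul _ _ (coprime_cPart_dPart hn0), hcn]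
      rw [hsplit]
      refine mul_le_mul_of_nonneg_left ?_ (hf0 c)
      have hd0 : dPart z n ≠ 0 := dPart_ne_zero hn0
      have hprimes : ∀ p ∈ (dPart z n).primeFactors, w ≤ (p : ℝ) := by
        intro p hp
        have h1 := cutPrime_le_of_mem_primeFactors_dPart hn0 hp
        have h2 : (cutPrime z n : ℝ) ≤ p := by exact_mod_cast h1
        linarith [(hTmem n hnT).2]
      have hdX : ((dPart z n : ℕ) : ℝ) ≤ 2 * x := by
        have : (dPart z n : ℝ) ≤ n := by exact_mod_cast Nat.div_le_self n _
        linarith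
      have hΩ := bigOmega_le_div_log hd0 (by linarith : (1 : ℝ) < w) hprimes hdX
      have hΩM : bigOmega (dPart z n) ≤ M := by exact_mod_cast hΩ.trans hM
      exact (le_pow_bigOmega hf0 hf1 hmul hB hd0).trans (pow_le_pow_right₀ hB1 hΩM)
    -- cardinality
    have hcard : #Tc ≤ #Dc := by
      refine card_le_card_of_div (c := c) (fun n hn => ?_) (fun n hn => ?_)
      · obtain ⟨hnT, hcn⟩ := hTc_mem n hn
        rw [← hcn]
        exact cPart_dvd (by have := hn2 n hnT; omega)
      · obtain ⟨hnT, hcn⟩ := hTc_mem n hn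
        have h2 := hn2 n hnT
        have hn0 : n ≠ 0 := by omega
        have hmain := (hTmem n hnT).1
        have hdvd : c ∣ n := hcn ▸ cPart_dvd hn0
        rw [hDc, Finset.mem_filter]
        refine ⟨div_mem_segSet hx hy0 hmain hc0 hdvd, ?_, ?_⟩
        · rw [← hb, Nat.mul_div_cancel' hdvd]
          exact (mem_mainSet.1 hmain).2.2
        · intro p hp hpd
          obtain ⟨hpw, hpp⟩ := Nat.mem_primesBelow.1 hp
          have hpw' : (p : ℝ) < w := Nat.lt_ceil.1 hpw
          have hd : n / c = dPart z n := by rw [dPart, hcn]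
          rw [hd] at hpd
          have hmem : p ∈ (dPart z n).primeFactors :=
            Nat.mem_primeFactors.2 ⟨hpp, hpd, dPart_ne_zero hn0⟩
          have h1 := cutPrime_le_of_mem_primeFactors_dPart hn0 hmem
          have h2 : (cutPrime z n : ℝ) ≤ p := by exact_mod_cast h1
          linarith [(hTmem n hnT).2]
    -- the sieve
    obtain ⟨hseg1, hseg2⟩ := segSet_length_le hx hy0 hc0
    have hD : (#Dc : ℝ) ≤ C₁ * ((y / c + 1) / ((Nat.totient k : ℝ) * Real.log w)) + w := by
      have := hsieve b _ _ hseg1 w hw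
      refine this.trans (add_le_add (mul_le_mul_of_nonneg_left ?_ hC₁.le) le_rfl)
      exact div_le_div_of_nonneg_right hseg2 (by positivity)
    calc ∑ n ∈ Tc, f n ≤ ∑ n ∈ Tc, f c * B ^ M := Finset.sum_le_sum hpt
      _ = #Tc * (f c * B ^ M) := by rw [Finset.sum_const, nsmul_eq_mul]
      _ ≤ #Dc * (f c * B ^ M) := by gcongr; exact mul_nonneg (hf0 c) hBM
      _ ≤ (C₁ * ((y / c + 1) / ((Nat.totient k : ℝ) * Real.log w)) + w) * (f c * B ^ M) :=
          mul_le_mul_of_nonneg_right hD (mul_nonneg (hf0 c) hBM)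
      _ = _ := by ring
  -- sum the inner bounds
  have hstep : ∀ c ∈ Cz, f c * B ^ M * (C₁ * ((y / c + 1) / ((Nat.totient k : ℝ) * Real.log w)) + w) ≤
      B ^ M * (C₁ * (y + z) / ((Nat.totient k : ℝ) * Real.log w) + w * z) * (f c / c) := by
    intro c hc
    rw [hCz, Finset.mem_filter, Finset.mem_Icc] at hc
    obtain ⟨⟨hc1, hcz⟩, -⟩ := hc
    have hc0' : (0 : ℝ) < c := by exact_mod_cast hc1
    have hcz' : (c : ℝ) ≤ z := (Nat.le_floor_iff (by linarith)).1 hcz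
    have hg : 0 ≤ f c / c := div_nonneg (hf0 c) hc0'.le
    have heq : f c * B ^ M * (C₁ * ((y / c + 1) / ((Nat.totient k : ℝ) * Real.log w)) + w) =
        B ^ M * (C₁ * (y + c) / ((Nat.totient k : ℝ) * Real.log w) + w * c) * (f c / c) := by
      field_simp
    rw [heq]
    gcongr
  calc ∑ c ∈ Cz, ∑ n ∈ T.filter (fun n => cPart z n = c), f n
      ≤ ∑ c ∈ Cz, f c * B ^ M * (C₁ * ((y / c + 1) / ((Nat.totient k : ℝ) * Real.log w)) + w) :=
        Finset.sum_le_sum hinner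
    _ ≤ ∑ c ∈ Cz, B ^ M * (C₁ * (y + z) / ((Nat.totient k : ℝ) * Real.log w) + w * z) * (f c / c) :=
        Finset.sum_le_sum hstep
    _ = B ^ M * (C₁ * (y + z) / ((Nat.totient k : ℝ) * Real.log w) + w * z) * ∑ c ∈ Cz, f c / c := by
        rw [Finset.mul_sum]
    _ ≤ _ := by
        refine mul_le_mul_of_nonneg_left ?_ (by positivity)
        -- the Euler bound with `η = 0`
        have hfl1 : (1 : ℝ) ≤ (⌊z⌋₊ : ℝ) := by exact_mod_cast Nat.le_floor (by simpa using hz1)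
        have h := rankin_tail hf0 hf1 hmul hB1 hB hA (η := 0) le_rfl (by norm_num)
          (v := (⌊z⌋₊ : ℝ) + 1) (w := 1) (by linarith) one_pos k (S := Cz)
          (fun c hc => by
            have := (Finset.mem_Icc.1 (Finset.mem_filter.1 hc).1).1; omega)
          (fun c hc => by exact_mod_cast (Finset.mem_Icc.1 (Finset.mem_filter.1 hc).1).1)
          (fun c hc => (Finset.mem_filter.1 hc).2)
          (fun c hc p hp => by
            have hcz : c ≤ ⌊z⌋₊ := (Finset.mem_Icc.1 (Finset.mem_filter.1 hc).1).2
            have : p ≤ c := Nat.le_of_mem_primeFactors hp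
            have : ((p : ℕ) : ℝ) ≤ (⌊z⌋₊ : ℝ) := by exact_mod_cast this.trans hcz
            linarith)
        rw [neg_zero, Real.rpow_zero, one_mul, mul_zero, zero_mul, zero_mul, add_zero] at h
        exact h

/-! ### Class II: a large prime-power divisor -/

/-- `∑_{1 ≤ i ≤ N} 1/i ≤ 1 + log N` over `ℝ` (Mathlib's `harmonic_le_one_add_log`). [folklore] -/
theorem sum_Icc_inv_le_one_add_log (N : ℕ) :
    ∑ i ∈ Icc 1 N, (1 : ℝ) / i ≤ 1 + Real.log N := by
  have h := harmonic_le_one_add_log N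
  rw [harmonic_eq_sum_Icc, Rat.cast_sum] at h
  simp only [Rat.cast_inv, Rat.cast_natCast] at h
  simpa only [one_div] using h

/-- `1 + log w ≤ 7 w^{1/6}` for `w ≥ 1`. [folklore] -/
theorem one_add_log_le {w : ℝ} (hw : 1 ≤ w) : 1 + Real.log w ≤ 7 * w ^ (1 / 6 : ℝ) := by
  have h1 := Real.log_le_rpow_div (by linarith : (0 : ℝ) ≤ w) (by norm_num : (0 : ℝ) < 1 / 6)
  have h2 : (1 : ℝ) ≤ w ^ (1 / 6 : ℝ) := Real.one_le_rpow hw (by norm_num)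
  linarith

/-- The exponent `e_P = ⌊log_P w⌋ + 1`: the least `e` with `P^e > w`. [folklore] -/
def ePow (w : ℝ) (P : ℕ) : ℕ := Nat.log P ⌊w⌋₊ + 1

/-- `w < P^{e_P}`. [folklore] -/
theorem lt_pow_ePow (w : ℝ) {P : ℕ} (hP : 1 < P) : w < (P : ℝ) ^ ePow w P := by
  have h := Nat.lt_pow_succ_log_self hP ⌊w⌋₊
  have h' : ((⌊w⌋₊ + 1 : ℕ) : ℝ) ≤ ((P ^ ePow w P : ℕ) : ℝ) := by exact_mod_cast h
  push_cast at h'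
  linarith [Nat.lt_floor_add_one w]

/-- `P^{e_P - 1} ≤ w` (`w ≥ 1`). [folklore] -/
theorem pow_ePow_sub_one_le {w : ℝ} (hw : 1 ≤ w) (P : ℕ) : (P : ℝ) ^ (ePow w P - 1) ≤ w := by
  have hfl : ⌊w⌋₊ ≠ 0 := (Nat.lt_of_lt_of_le Nat.zero_lt_one (Nat.le_floor (by simpa using hw))).ne'
  have h := Nat.pow_log_le_self P hfl
  rw [ePow, Nat.add_sub_cancel]
  have h' : ((P ^ Nat.log P ⌊w⌋₊ : ℕ) : ℝ) ≤ (⌊w⌋₊ : ℝ) := by exact_mod_cast h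
  push_cast at h'
  exact h'.trans (Nat.floor_le (by linarith))

/-- `2 ≤ e_P` when `P ≤ w`. [folklore] -/
theorem two_le_ePow {w : ℝ} {P : ℕ} (hP : 1 < P) (hPw : (P : ℝ) ≤ w) : 2 ≤ ePow w P := by
  rw [ePow]
  have : 1 ≤ Nat.log P ⌊w⌋₊ := Nat.le_log_of_pow_le hP (by rw [pow_one]; exact Nat.le_floor hPw)
  omega

/-- The key inequality of class II: `√w · P ≤ P^{e_P}` for `P ≤ w`, `P ≥ 2` prime-like. [folklore] -/
theorem sqrt_mul_le_pow_ePow {w : ℝ} (hw : 1 ≤ w) {P : ℕ} (hP : 1 < P) (hPw : (P : ℝ) ≤ w) :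
    Real.sqrt w * P ≤ (P : ℝ) ^ ePow w P := by
  have hP0 : (0 : ℝ) ≤ P := Nat.cast_nonneg P
  have hlt := lt_pow_ePow w hP
  have h2 := two_le_ePow hP hPw
  have hsq : (P : ℝ) * P ≤ (P : ℝ) ^ ePow w P := by
    rw [← pow_two]
    exact pow_le_pow_right₀ (by exact_mod_cast hP.le) h2
  have hws : Real.sqrt w * Real.sqrt w = w := Real.mul_self_sqrt (by linarith)
  have hs0 : 0 ≤ Real.sqrt w := Real.sqrt_nonneg w
  by_cases hc : (P : ℝ) ≤ Real.sqrt w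
  · calc Real.sqrt w * P ≤ Real.sqrt w * Real.sqrt w := mul_le_mul_of_nonneg_left hc hs0
      _ = w := hws
      _ ≤ (P : ℝ) ^ ePow w P := hlt.le
  · rw [not_le] at hc
    calc Real.sqrt w * P ≤ (P : ℝ) * P := mul_le_mul_of_nonneg_right hc.le hP0
      _ ≤ (P : ℝ) ^ ePow w P := hsq

/-- `∑_{P ≤ w prime} P^{-e_P} ≤ 7 w^{-1/3}` (`w ≥ 1`). [folklore] -/
theorem sum_inv_pow_ePow_le {w : ℝ} (hw : 1 ≤ w) :
    ∑ P ∈ Nat.primesLE ⌊w⌋₊, ((P : ℝ) ^ ePow w P)⁻¹ ≤ 7 * w ^ (-(1 / 3 : ℝ)) := by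
  have hw0 : 0 < w := by linarith
  have hs0 : 0 < Real.sqrt w := Real.sqrt_pos.2 hw0
  have hpt : ∀ P ∈ Nat.primesLE ⌊w⌋₊, ((P : ℝ) ^ ePow w P)⁻¹ ≤ (Real.sqrt w)⁻¹ * ((1 : ℝ) / P) := by
    intro P hP
    obtain ⟨hPw, hPp⟩ := Nat.mem_primesLE.1 hP
    have hPw' : (P : ℝ) ≤ w := (Nat.le_floor_iff hw0.le).1 hPw
    have hP0 : (0 : ℝ) < P := by exact_mod_cast hPp.pos
    have h := sqrt_mul_le_pow_ePow hw hPp.one_lt hPw'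
    rw [one_div, ← mul_inv]
    exact inv_anti₀ (mul_pos hs0 hP0) h
  refine (Finset.sum_le_sum hpt).trans ?_
  rw [← Finset.mul_sum]
  have hsub : Nat.primesLE ⌊w⌋₊ ⊆ Icc 1 ⌊w⌋₊ := fun P hP => by
    obtain ⟨hPw, hPp⟩ := Nat.mem_primesLE.1 hP
    exact Finset.mem_Icc.2 ⟨hPp.one_lt.le, hPw⟩
  have hharm : ∑ P ∈ Nat.primesLE ⌊w⌋₊, (1 : ℝ) / P ≤ 1 + Real.log w := by
    refine (Finset.sum_le_sum_of_subset_of_nonneg hsub fun i _ _ => by positivity).trans ?_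
    refine (sum_Icc_inv_le_one_add_log ⌊w⌋₊).trans ?_
    have hfl1 : (1 : ℝ) ≤ ⌊w⌋₊ := by exact_mod_cast Nat.le_floor (by simpa using hw)
    have := Real.log_le_log (by linarith) (Nat.floor_le hw0.le)
    linarith
  calc (Real.sqrt w)⁻¹ * ∑ P ∈ Nat.primesLE ⌊w⌋₊, (1 : ℝ) / P
      ≤ (Real.sqrt w)⁻¹ * (7 * w ^ (1 / 6 : ℝ)) :=
        mul_le_mul_of_nonneg_left (hharm.trans (one_add_log_le hw)) (inv_nonneg.2 hs0.le)
    _ = 7 * w ^ (-(1 / 3 : ℝ)) := by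
        rw [Real.sqrt_eq_rpow, ← Real.rpow_neg hw0.le, mul_left_comm, ← Real.rpow_add hw0]
        norm_num

/-- **Class II** (Shiu 1980, §5, `∑_{II}`): if `P_n ≤ w` and `c_n ≤ w` (`w² = z`) then
`P_n^{v}` with `c_n P_n^{v} > z` exceeds `w`, so `P_n^{e_{P_n}} ∣ n` with `e ≥ 2`; counting the
multiples of `P^{e_P}` in the progression and using `f(n) ≤ F` gives
`∑_{II} f(n) ≤ F (7 (y+1)/k · w^{-1/3} + w)`. [cite: Shiu1980, §5 (∑_II)] -/
theorem classII_bound {f : ℕ → ℝ} {x y z w : ℝ} {k a : ℕ} {F : ℝ} (hF0 : 0 ≤ F)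
    (hF : ∀ n ∈ mainSet x y k a, f n ≤ F)
    (hx : 1 ≤ x) (hy : 0 < y) (hzx : z ≤ x) (hw : 2 ≤ w) (hwz : w * w = z)
    (hk : 0 < k) (hak : a.Coprime k) :
    ∑ n ∈ (mainSet x y k a).filter (fun n => (cutPrime z n : ℝ) ≤ w ∧ (cPart z n : ℝ) ≤ w), f n ≤
      F * (7 * ((y + 1) / k) * w ^ (-(1 / 3 : ℝ)) + w) := by
  classical
  set T := (mainSet x y k a).filter (fun n => (cutPrime z n : ℝ) ≤ w ∧ (cPart z n : ℝ) ≤ w) with hT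
  have hy0 : 0 ≤ y := hy.le
  have hw1 : 1 ≤ w := by linarith
  have hw0 : 0 < w := by linarith
  have hz1 : 1 ≤ z := by nlinarith
  have hk0 : (0 : ℝ) < k := by exact_mod_cast hk
  -- Step 1: `∑ f ≤ F #T`
  have h1 : ∑ n ∈ T, f n ≤ F * #T := by
    calc ∑ n ∈ T, f n ≤ ∑ n ∈ T, F := Finset.sum_le_sum fun n hn => hF n (Finset.mem_filter.1 hn).1
      _ = F * #T := by rw [Finset.sum_const, nsmul_eq_mul, mul_comm]
  refine h1.trans (mul_le_mul_of_nonneg_left ?_ hF0)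
  -- Step 2: `T ⊆ ⋃_P {n : P^{e_P} ∣ n}`
  set Pk := (Nat.primesLE ⌊w⌋₊).filter (fun P : ℕ => ¬ P ∣ k) with hPk
  set MP : ℕ → Finset ℕ := fun P => (mainSet x y k a).filter (fun n => P ^ ePow w P ∣ n) with hMP
  have hsub : T ⊆ Pk.biUnion MP := by
    intro n hn
    obtain ⟨hmain, hPw, hcw⟩ := Finset.mem_filter.1 hn
    obtain ⟨hxn, -, hn2, -⟩ := mainSet_props hx hy0 hmain
    have hn0 : n ≠ 0 := by omega
    obtain ⟨hPmem, -⟩ := cutPrime_mem hn2 hz1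
    set P := cutPrime z n with hPdef
    have hP : P.Prime := Nat.prime_of_mem_primeFactors hPmem
    have hPn : P ∣ n := Nat.dvd_of_mem_primeFactors hPmem
    rw [Finset.mem_biUnion]
    refine ⟨P, Finset.mem_filter.2 ⟨Nat.mem_primesLE.2 ⟨Nat.le_floor hPw, hP⟩, fun hPk => ?_⟩, ?_⟩
    · have hcop := coprime_of_mem_mainSet hak hmain
      exact (Nat.Prime.one_lt hP).ne' (Nat.Coprime.eq_one_of_dvd (hcop.coprime_dvd_left hPn) hPk)
    · rw [hMP, Finset.mem_filter]
      refine ⟨hmain, ?_⟩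
      -- `P^t > w ≥ P^{e_P - 1}` forces `e_P ≤ t`
      have hcut := lt_cPart_mul_pow hn2 hz1 (lt_of_le_of_lt hzx hxn)
      rw [← hPdef] at hcut
      set t := n.factorization P with ht
      have hPt : w < (P : ℝ) ^ t := by
        by_contra hle
        rw [not_lt] at hle
        have hc0 : (0 : ℝ) ≤ cPart z n := Nat.cast_nonneg _
        have : (cPart z n : ℝ) * (P : ℝ) ^ t ≤ w * w :=
          mul_le_mul hcw hle (by positivity) hw0.le
        linarith
      have hlt : ePow w P - 1 < t := by
        have h1 : (P : ℝ) ^ (ePow w P - 1) < (P : ℝ) ^ t := lt_of_le_of_lt (pow_ePow_sub_one_le hw1 P) hPt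
        exact (pow_lt_pow_iff_right₀ (by exact_mod_cast hP.one_lt)).1 h1
      have hle : ePow w P ≤ t := by omega
      exact (pow_dvd_pow P hle).trans (Nat.ordProj_dvd n P)
  -- Step 3: count each `MP`
  have hlen : ((⌊x + y⌋₊ : ℕ) : ℝ) - ((⌊x⌋₊ : ℕ) : ℝ) ≤ y + 1 := by
    have h1 : ((⌊x + y⌋₊ : ℕ) : ℝ) ≤ x + y := Nat.floor_le (by linarith)
    have h2 : x - 1 < ((⌊x⌋₊ : ℕ) : ℝ) := Nat.sub_one_lt_floor x
    linarith
  have hfloor : ⌊x⌋₊ ≤ ⌊x + y⌋₊ := Nat.floor_le_floor (by linarith)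
  have hMP_card : ∀ P ∈ Pk, (#(MP P) : ℝ) ≤ (y + 1) / k * ((P : ℝ) ^ ePow w P)⁻¹ + 1 := by
    intro P hP
    obtain ⟨hP1, hPk⟩ := Finset.mem_filter.1 hP
    obtain ⟨-, hPp⟩ := Nat.mem_primesLE.1 hP1
    have hcop : k.Coprime (P ^ ePow w P) :=
      Nat.Coprime.pow_right _ (Nat.coprime_comm.1 (hPp.coprime_iff_not_dvd.2 hPk))
    have h := card_segment_modEq_dvd_le hk (pow_pos hPp.pos _) hcop a hfloor
    have hMP' : MP P = (Ioc ⌊x⌋₊ ⌊x + y⌋₊).filter (fun n : ℕ => n ≡ a [MOD k] ∧ P ^ ePow w P ∣ n) := by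
      simp only [hMP, mainSet, Finset.filter_filter]
    rw [hMP']
    push_cast at h
    refine h.trans (add_le_add ?_ le_rfl)
    rw [← div_eq_mul_inv, div_div]
    exact div_le_div_of_nonneg_right hlen (by positivity)
  -- Step 4: sum up
  have hPk_card : (#Pk : ℝ) ≤ w := by
    have h1 : #Pk ≤ #(Icc 1 ⌊w⌋₊) := Finset.card_le_card fun P hP => by
      obtain ⟨hPw, hPp⟩ := Nat.mem_primesLE.1 (Finset.mem_filter.1 hP).1
      exact Finset.mem_Icc.2 ⟨hPp.one_lt.le, hPw⟩
    rw [Nat.card_Icc, Nat.add_sub_cancel] at h1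
    exact (Nat.cast_le.2 h1).trans (Nat.floor_le hw0.le)
  calc (#T : ℝ) ≤ #(Pk.biUnion MP) := by exact_mod_cast Finset.card_le_card hsub
    _ ≤ ∑ P ∈ Pk, (#(MP P) : ℝ) := by exact_mod_cast Finset.card_biUnion_le
    _ ≤ ∑ P ∈ Pk, ((y + 1) / k * ((P : ℝ) ^ ePow w P)⁻¹ + 1) := Finset.sum_le_sum hMP_card
    _ = (y + 1) / k * ∑ P ∈ Pk, ((P : ℝ) ^ ePow w P)⁻¹ + #Pk := by
        rw [Finset.sum_add_distrib, Finset.mul_sum, Finset.sum_const, nsmul_eq_mul, mul_one]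
    _ ≤ (y + 1) / k * (7 * w ^ (-(1 / 3 : ℝ))) + w := by
        refine add_le_add (mul_le_mul_of_nonneg_left ?_ (by positivity)) hPk_card
        refine le_trans ?_ (sum_inv_pow_ePow_le hw1)
        exact Finset.sum_le_sum_of_subset_of_nonneg (Finset.filter_subset _ _)
          fun P _ _ => by positivity
    _ = 7 * ((y + 1) / k) * w ^ (-(1 / 3 : ℝ)) + w := by ring

/-! ### Class III: a large, very smooth `c_n` -/

/-- The Rankin constant `exp(∑_{p<N} (p^{-2/3} + 4 p^{-4/3}))` of `sum_div_le_rankin` with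
`g ≡ 1`, `W = 1`, `η = 1/3`. [folklore] -/
def KL (N : ℕ) : ℝ :=
  Real.exp (∑ p ∈ Nat.primesBelow N, ((1 : ℝ) * (p : ℝ) ^ ((1 / 3 : ℝ) - 1) +
    4 * 1 * (p : ℝ) ^ (2 * (1 / 3 : ℝ) - 2)))

/-- The Rankin constant `∏_{p<N} (1 - p^{-1/2})⁻¹` of `card_smoothNumbersUpTo_le_rankin`. [folklore] -/
def KL' (N : ℕ) : ℝ := ∏ p ∈ Nat.primesBelow N, (1 - (p : ℝ) ^ (-(1 / 2 : ℝ)))⁻¹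

/-- `K'_L ≥ 0`. [folklore] -/
theorem KL'_nonneg (N : ℕ) : 0 ≤ KL' N := by
  unfold KL'
  refine Finset.prod_nonneg fun p hp => inv_nonneg.2 ?_
  have hpp := Nat.prime_of_mem_primesBelow hp
  rw [sub_nonneg]
  exact Real.rpow_le_one_of_one_le_of_nonpos (by exact_mod_cast hpp.one_lt.le) (by norm_num)

/-- **Class III** (Shiu 1980, §5, `∑_{III}`): the `n` with `c_n > w` and cut prime `P_n ≤ L`
(`L < N`): then `c_n ∈ (w, z]` is `N`-smooth and prime to `k`; each `c` carries at most
`y/(ck) + 2` values of `n`, and Rankin's trick bounds `∑_{c > w} 1/c ≤ w^{-1/3} K_L`,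
`#{c ≤ z} ≤ z^{1/2} K'_L`.  With `f(n) ≤ F`:
`∑_{III} f(n) ≤ F ((y/k) w^{-1/3} K_L(N) + 2 w K'_L(N))`. [cite: Shiu1980, §5 (∑_III)] -/
theorem classIII_bound {f : ℕ → ℝ} {x y z w L : ℝ} {k a : ℕ} {F : ℝ} (hF0 : 0 ≤ F)
    (hF : ∀ n ∈ mainSet x y k a, f n ≤ F)
    (hx : 1 ≤ x) (hy : 0 < y) (hw : 2 ≤ w) (hwz : w * w = z)
    (hk : 0 < k) (hak : a.Coprime k) {N : ℕ} (hLN : L < N) :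
    ∑ n ∈ (mainSet x y k a).filter (fun n => (cutPrime z n : ℝ) ≤ L ∧ w < (cPart z n : ℝ)), f n ≤
      F * (y / k * w ^ (-(1 / 3 : ℝ)) * KL N + 2 * w * KL' N) := by
  classical
  set T := (mainSet x y k a).filter (fun n => (cutPrime z n : ℝ) ≤ L ∧ w < (cPart z n : ℝ)) with hT
  have hy0 : 0 ≤ y := hy.le
  have hw1 : 1 ≤ w := by linarith
  have hw0 : 0 < w := by linarith
  have hz1 : 1 ≤ z := by nlinarith
  have hz0 : 0 ≤ z := by linarith
  have hk0 : (0 : ℝ) < k := by exact_mod_cast hk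
  have hk1 : (1 : ℝ) ≤ k := by exact_mod_cast hk
  -- Step 1
  have h1 : ∑ n ∈ T, f n ≤ F * #T := by
    calc ∑ n ∈ T, f n ≤ ∑ n ∈ T, F := Finset.sum_le_sum fun n hn => hF n (Finset.mem_filter.1 hn).1
      _ = F * #T := by rw [Finset.sum_const, nsmul_eq_mul, mul_comm]
  refine h1.trans (mul_le_mul_of_nonneg_left ?_ hF0)
  -- Step 2: the fibres over `c`
  set C₀ := (Icc 1 ⌊z⌋₊).filter (fun c : ℕ => c.Coprime k ∧ ∀ p ∈ c.primeFactors, p < N) with hC₀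
  set C := C₀.filter (fun c : ℕ => w < (c : ℝ)) with hC
  have hmaps : (T : Set ℕ).MapsTo (cPart z) C := by
    intro n hn
    obtain ⟨hmain, hPL, hcw⟩ := Finset.mem_filter.1 (Finset.mem_coe.1 hn)
    obtain ⟨-, -, hn2, -⟩ := mainSet_props hx hy0 hmain
    have hn0 : n ≠ 0 := by omega
    rw [Finset.mem_coe, hC, Finset.mem_filter, hC₀, Finset.mem_filter, Finset.mem_Icc]
    refine ⟨⟨⟨Nat.one_le_iff_ne_zero.2 cPart_ne_zero, Nat.le_floor (cutPrime_mem hn2 hz1).2⟩,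
      Nat.Coprime.coprime_dvd_left (cPart_dvd hn0) (coprime_of_mem_mainSet hak hmain),
      fun p hp => ?_⟩, hcw⟩
    have h1 := lt_of_mem_primeFactors_cPart hp
    have h2 : (p : ℝ) < L := lt_of_lt_of_le (by exact_mod_cast h1) hPL
    exact_mod_cast h2.trans hLN
  rw [Finset.card_eq_sum_card_fiberwise hmaps]
  push_cast
  -- Step 3: each fibre
  have hfib : ∀ c ∈ C, (#(T.filter (fun n => cPart z n = c)) : ℝ) ≤ y / k * (1 / (c : ℝ)) + 2 := by
    intro c hc
    rw [hC, Finset.mem_filter, hC₀, Finset.mem_filter, Finset.mem_Icc] at hc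
    obtain ⟨⟨⟨hc1, -⟩, hck, -⟩, -⟩ := hc
    have hc0 : c ≠ 0 := by omega
    have hc0' : (0 : ℝ) < c := by exact_mod_cast hc1
    obtain ⟨b, hb⟩ := exists_residue_of_coprime hck hk.ne' a
    set Dc := (segSet x y c).filter (fun d : ℕ => d ≡ b [MOD k]) with hDc
    have hcard : #(T.filter (fun n => cPart z n = c)) ≤ #Dc := by
      refine card_le_card_of_div (c := c) (fun n hn => ?_) (fun n hn => ?_)
      · obtain ⟨hnT, hcn⟩ := Finset.mem_filter.1 hn
        obtain ⟨-, -, hn2, -⟩ := mainSet_props hx hy0 (Finset.mem_filter.1 hnT).1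
        rw [← hcn]
        exact cPart_dvd (by omega)
      · obtain ⟨hnT, hcn⟩ := Finset.mem_filter.1 hn
        have hmain := (Finset.mem_filter.1 hnT).1
        obtain ⟨-, -, hn2, -⟩ := mainSet_props hx hy0 hmain
        have hn0 : n ≠ 0 := by omega
        have hdvd : c ∣ n := hcn ▸ cPart_dvd hn0
        rw [hDc, Finset.mem_filter]
        refine ⟨div_mem_segSet hx hy0 hmain hc0 hdvd, ?_⟩
        rw [← hb, Nat.mul_div_cancel' hdvd]
        exact (mem_mainSet.1 hmain).2.2
    obtain ⟨hseg1, hseg2⟩ := segSet_length_le hx hy0 hc0 (x := x) (y := y)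
    have hD := card_segment_modEq_le hk b hseg1
    calc (#(T.filter (fun n => cPart z n = c)) : ℝ) ≤ #Dc := by exact_mod_cast hcard
      _ ≤ (y / c + 1) / k + 1 := hD.trans (by gcongr)
      _ = y / k * (1 / (c : ℝ)) + (1 / k + 1) := by ring
      _ ≤ y / k * (1 / (c : ℝ)) + 2 := by
          have : 1 / (k : ℝ) ≤ 1 := by rw [div_le_one hk0]; exact hk1
          linarith
  refine (Finset.sum_le_sum hfib).trans ?_
  rw [Finset.sum_add_distrib, ← Finset.mul_sum, Finset.sum_const, nsmul_eq_mul]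
  -- Step 4: Rankin twice
  have hsmooth : ∀ c ∈ C₀, c ∈ Nat.smoothNumbers N := by
    intro c hc
    rw [hC₀, Finset.mem_filter, Finset.mem_Icc] at hc
    exact Nat.mem_smoothNumbers_of_primeFactors_subset (by omega) fun p hp =>
      Finset.mem_range.2 (hc.2.2 p hp)
  -- (a) `∑_{c ∈ C} 1/c ≤ w^{-1/3} K_L`
  have hsum : ∑ c ∈ C, (1 : ℝ) / c ≤ w ^ (-(1 / 3 : ℝ)) * KL N := by
    have h := sum_div_le_rankin (g := fun _ : ℕ => (1 : ℝ)) (fun _ => zero_le_one) rfl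
      (fun _ => by simp) zero_le_one (fun _ _ _ _ => le_rfl) N
      (by norm_num : (0 : ℝ) ≤ 1 / 3) le_rfl hw0 hsmooth
    exact h
  -- (b) `#C ≤ #C₀ ≤ z^{1/2} K'_L ≤ w K'_L`
  have hcardC : (#C : ℝ) ≤ w * KL' N := by
    have h1 : #C ≤ #(Nat.smoothNumbersUpTo ⌊z⌋₊ N) := by
      refine (Finset.card_le_card (Finset.filter_subset _ _)).trans (Finset.card_le_card ?_)
      intro c hc
      rw [Nat.mem_smoothNumbersUpTo]
      exact ⟨(Finset.mem_Icc.1 (Finset.mem_filter.1 hc).1).2, hsmooth c hc⟩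
    have h2 := card_smoothNumbersUpTo_le_rankin ⌊z⌋₊ N (by norm_num : (0 : ℝ) < 1 / 2)
    have h3 : ((⌊z⌋₊ : ℕ) : ℝ) ^ (1 / 2 : ℝ) ≤ w := by
      calc ((⌊z⌋₊ : ℕ) : ℝ) ^ (1 / 2 : ℝ) ≤ z ^ (1 / 2 : ℝ) :=
            Real.rpow_le_rpow (Nat.cast_nonneg _) (Nat.floor_le hz0) (by norm_num)
        _ = w := by rw [← Real.sqrt_eq_rpow, ← hwz, Real.sqrt_mul_self hw0.le]
    calc (#C : ℝ) ≤ #(Nat.smoothNumbersUpTo ⌊z⌋₊ N) := by exact_mod_cast h1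
      _ ≤ ((⌊z⌋₊ : ℕ) : ℝ) ^ (1 / 2 : ℝ) * KL' N := h2
      _ ≤ w * KL' N := mul_le_mul_of_nonneg_right h3 (KL'_nonneg N)
  calc y / k * ∑ c ∈ C, (1 : ℝ) / c + #C * 2
      ≤ y / k * (w ^ (-(1 / 3 : ℝ)) * KL N) + w * KL' N * 2 :=
        add_le_add (mul_le_mul_of_nonneg_left hsum (by positivity))
          (mul_le_mul_of_nonneg_right hcardC (by norm_num))
    _ = y / k * w ^ (-(1 / 3 : ℝ)) * KL N + 2 * w * KL' N := by ring

/-! ### Class IV: `c_n > w` and a cut prime of intermediate size -/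

/-- The uniform factor `Λ = exp(∑_{p ≤ z, p ∤ k} f(p)/p + B e^{K₁}(K₁ + 1) + K₅)` of class IV. [folklore] -/
def LamIV (f : ℕ → ℝ) (z : ℝ) (k : ℕ) (B K₁ A : ℝ) : ℝ :=
  Real.exp (∑ p ∈ primesBelowNotDvd ((⌊z⌋₊ : ℝ) + 1) k, f p / p + B * Real.exp K₁ * (K₁ + 1) + K₅ A B)

/-- `n + 1 ≤ 2^n`. [folklore] -/
theorem succ_le_two_pow (n : ℕ) : n + 1 ≤ 2 ^ n := Nat.lt_two_pow_self

set_option maxHeartbeats 400000 in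
/-- **Class IV at level `r`** (Shiu 1980, §5, `∑_{IV}`, the terms with
`z^{1/(r+1)} < P_n ≤ z^{1/r}`): `c_n ∈ (w, z]` is `z^{1/r}`-smooth and prime to `k`, `d_n` has all
its prime factors `> z^{1/(r+1)}` so `f(d_n) ≤ B^{(r+1)M₁}` and the `d` are counted by the sieve
of level `z^{1/(r+1)}`; Rankin's trick with exponent `η = K₁ r / log z ≤ 1/6` saves `e^{-K₁ r/2}`.
[cite: Shiu1980, §5 (∑_IV) and Lemma 3] -/
theorem classIV_r_bound {f : ℕ → ℝ} (hf0 : ∀ n, 0 ≤ f n) (hf1 : f 1 = 1)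
    (hmul : ∀ m n : ℕ, m.Coprime n → f (m * n) = f m * f n)
    {B : ℝ} (hB1 : 1 ≤ B) (hB : ∀ p l : ℕ, p.Prime → 1 ≤ l → f (p ^ l) ≤ B ^ l)
    {A : ℝ} (hA : ∀ n : ℕ, 1 ≤ n → f n ≤ A * (n : ℝ) ^ (1 / 6 : ℝ))
    {x y z w L : ℝ} (hx : 1 ≤ x) (hy : 0 < y) (hyx : y ≤ x) (hw : 2 ≤ w)
    (hwz : w * w = z) (hL : 4 ≤ L)
    {k a : ℕ} (hk : 0 < k) (hak : a.Coprime k)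
    {M₁ : ℕ} (hM₁ : Real.log (2 * x) / Real.log z ≤ M₁)
    {K₁ : ℝ} (hK₁ : 0 ≤ K₁) (hLK : 6 * K₁ ≤ Real.log L) {C₁ : ℝ} (hC₁ : 0 < C₁)
    (hsieve : ∀ (b X₁ X₂ : ℕ), X₁ ≤ X₂ → ∀ (u : ℝ), 2 ≤ u →
      (#((Ioc X₁ X₂).filter fun d : ℕ => d ≡ b [MOD k] ∧ ∀ p ∈ Nat.primesBelow ⌈u⌉₊, ¬ p ∣ d) : ℝ) ≤
        C₁ * (((X₂ : ℝ) - X₁) / ((Nat.totient k : ℝ) * Real.log u)) + u)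
    (r : ℕ) :
    ∑ n ∈ (mainSet x y k a).filter (fun n => L < (cutPrime z n : ℝ) ∧ (cutPrime z n : ℝ) ≤ w ∧
        w < (cPart z n : ℝ) ∧ ⌊Real.log z / Real.log (cutPrime z n)⌋₊ = r), f n ≤
      B ^ ((r + 1) * M₁) * Real.exp (-(K₁ * r / 2)) *
        (C₁ * (r + 1) * (y + z) / ((Nat.totient k : ℝ) * Real.log z) + z ^ (1 / 3 : ℝ) * z) *
          LamIV f z k B K₁ A := by
  set T := (mainSet x y k a).filter (fun n => L < (cutPrime z n : ℝ) ∧ (cutPrime z n : ℝ) ≤ w ∧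
        w < (cPart z n : ℝ) ∧ ⌊Real.log z / Real.log (cutPrime z n)⌋₊ = r) with hT
  have hy0 : 0 ≤ y := hy.le
  have hw0 : 0 < w := by linarith
  have hw1 : 1 < w := by linarith
  have hz4 : 4 ≤ z := by nlinarith
  have hz1 : 1 ≤ z := by linarith
  have hz0 : 0 < z := by linarith
  have hlogz : 0 < Real.log z := Real.log_pos (by linarith)
  have hlogw : Real.log z = 2 * Real.log w := by
    rw [← hwz, Real.log_mul hw0.ne' hw0.ne']; ring
  have hφ : (0 : ℝ) < Nat.totient k := by exact_mod_cast Nat.totient_pos.2 hk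
  have hΛ : 0 < LamIV f z k B K₁ A := Real.exp_pos _
  have hRHS0 : 0 ≤ B ^ ((r + 1) * M₁) * Real.exp (-(K₁ * r / 2)) *
      (C₁ * (r + 1) * (y + z) / ((Nat.totient k : ℝ) * Real.log z) + z ^ (1 / 3 : ℝ) * z) *
        LamIV f z k B K₁ A := by positivity
  -- the empty case
  by_cases hTe : T = ∅
  · rw [hTe, Finset.sum_empty]; exact hRHS0
  obtain ⟨n₀, hn₀⟩ := Finset.nonempty_iff_ne_empty.2 hTe
  -- facts about the members of `T`
  have hmem : ∀ n ∈ T, n ∈ mainSet x y k a ∧ L < (cutPrime z n : ℝ) ∧ (cutPrime z n : ℝ) ≤ w ∧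
      w < (cPart z n : ℝ) ∧ ⌊Real.log z / Real.log (cutPrime z n)⌋₊ = r := by
    intro n hn
    obtain ⟨h1, h2, h3, h4, h5⟩ := Finset.mem_filter.1 hn
    exact ⟨h1, h2, h3, h4, h5⟩
  -- `r ≥ 2`, `r log P ≤ log z < (r+1) log P`, `r log L ≤ log z`
  have hrfacts : ∀ n ∈ T, 2 ≤ r ∧ (r : ℝ) * Real.log (cutPrime z n) ≤ Real.log z ∧
      Real.log z < (r + 1) * Real.log (cutPrime z n) ∧ (r : ℝ) * Real.log L ≤ Real.log z ∧
      Real.log L < Real.log (cutPrime z n) := by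
    intro n hn
    obtain ⟨-, hLP, hPw, -, hr⟩ := hmem n hn
    set P : ℝ := (cutPrime z n : ℝ) with hP
    have hP1 : 1 < P := by linarith
    have hlogP : 0 < Real.log P := Real.log_pos hP1
    have hlogLP : Real.log L < Real.log P := Real.log_lt_log (by linarith) hLP
    have hq0 : 0 ≤ Real.log z / Real.log P := div_nonneg hlogz.le hlogP.le
    have hr_le : (r : ℝ) ≤ Real.log z / Real.log P := by rw [← hr]; exact Nat.floor_le hq0
    have hr_lt : Real.log z / Real.log P < r + 1 := by rw [← hr]; exact Nat.lt_floor_add_one _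
    refine ⟨?_, ?_, ?_, ?_, hlogLP⟩
    · -- `2 log P ≤ 2 log w = log z`
      have h2 : (2 : ℝ) ≤ Real.log z / Real.log P := by
        rw [le_div_iff₀ hlogP, hlogw]
        have := Real.log_le_log (by linarith) hPw
        linarith
      rw [← hr]
      exact Nat.le_floor h2
    · rwa [le_div_iff₀ hlogP] at hr_le
    · rwa [div_lt_iff₀ hlogP] at hr_lt
    · have h1 : (r : ℝ) * Real.log L ≤ r * Real.log P :=
        mul_le_mul_of_nonneg_left hlogLP.le (Nat.cast_nonneg r)
      rw [le_div_iff₀ hlogP] at hr_le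
      linarith
  obtain ⟨hr2, -, -, hrL, -⟩ := hrfacts n₀ hn₀
  have hr0 : (0 : ℝ) < r := by exact_mod_cast (by omega : 0 < r)
  have hr0' : (r : ℝ) ≠ 0 := hr0.ne'
  -- the parameters `u = z^{1/(r+1)}`, `v = z^{1/r}`, `η = K₁ r / log z`
  set u : ℝ := z ^ (1 / ((r : ℝ) + 1)) with hu
  set v : ℝ := z ^ (1 / (r : ℝ)) with hv
  set η : ℝ := K₁ * r / Real.log z with hη
  have hu0 : 0 < u := Real.rpow_pos_of_pos hz0 _
  have hv0 : 0 < v := Real.rpow_pos_of_pos hz0 _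
  have hlogu : Real.log u = Real.log z / (r + 1) := by
    rw [hu, Real.log_rpow hz0]; ring
  have hlogv : Real.log v = Real.log z / r := by
    rw [hv, Real.log_rpow hz0]; ring
  have hη0 : 0 ≤ η := by positivity
  have hlogL : 0 < Real.log L := Real.log_pos (by linarith)
  have hη6 : η ≤ 1 / 6 := by
    -- `η = K₁ r / log z ≤ K₁ / log L ≤ 1/6`
    rw [hη, div_le_iff₀ hlogz]
    have h1 : K₁ * r * Real.log L ≤ K₁ * Real.log z := by
      rw [mul_assoc]; exact mul_le_mul_of_nonneg_left hrL hK₁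
    have h2 : K₁ * Real.log z ≤ 1 / 6 * Real.log z * Real.log L := by nlinarith
    nlinarith
  -- `2 ≤ u`: `(r+1) log 2 ≤ log z`
  have hu2 : 2 ≤ u := by
    have hlog4 : Real.log 4 = 2 * Real.log 2 := by
      rw [show (4 : ℝ) = 2 ^ 2 by norm_num, Real.log_pow]; ring
    have hlogL4 : Real.log 4 ≤ Real.log L := Real.log_le_log (by norm_num) hL
    have hlog2z : 2 * Real.log 2 ≤ Real.log z := by
      rw [← hlog4]; exact Real.log_le_log (by norm_num) hz4
    have h1 : ((r : ℝ) + 1) * Real.log 2 ≤ Real.log z := by nlinarith [Real.log_pos one_lt_two]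
    have h2 : Real.log 2 ≤ Real.log u := by
      rw [hlogu, le_div_iff₀ (by positivity)]; linarith
    exact (Real.log_le_log_iff (by norm_num) hu0).1 h2
  have hu1 : 1 < u := by linarith
  -- `u ≤ z^{1/3}`, `v ≤ z`
  have huz : u ≤ z ^ (1 / 3 : ℝ) := by
    refine Real.rpow_le_rpow_of_exponent_le hz1 ?_
    rw [div_le_div_iff₀ (by positivity) (by norm_num)]
    have : (2 : ℝ) ≤ r := by exact_mod_cast hr2
    linarith
  have hvz : v ≤ z := by
    conv_rhs => rw [← Real.rpow_one z]
    refine Real.rpow_le_rpow_of_exponent_le hz1 ?_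
    rw [div_le_one hr0]
    have : (2 : ℝ) ≤ r := by exact_mod_cast hr2
    linarith
  have hv2 : 2 ≤ v := by
    -- `v ≥ u ≥ 2`
    refine hu2.trans (Real.rpow_le_rpow_of_exponent_le hz1 ?_)
    exact div_le_div_of_nonneg_left zero_le_one hr0 (by linarith)
  -- per-`n` consequences: `u < P ≤ v`
  have hPuv : ∀ n ∈ T, u < (cutPrime z n : ℝ) ∧ (cutPrime z n : ℝ) ≤ v := by
    intro n hn
    obtain ⟨-, hLP, -, -, -⟩ := hmem n hn
    obtain ⟨-, hrP, hPr, -, -⟩ := hrfacts n hn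
    set P : ℝ := (cutPrime z n : ℝ) with hP
    have hP0 : 0 < P := by linarith
    constructor
    · -- `log u = log z/(r+1) < log P`
      have h1 : Real.log u < Real.log P := by
        rw [hlogu, div_lt_iff₀ (by positivity)]; linarith
      exact (Real.log_lt_log_iff hu0 hP0).1 h1
    · have h1 : Real.log P ≤ Real.log v := by
        rw [hlogv, le_div_iff₀ hr0]; linarith
      exact (Real.log_le_log_iff hP0 hv0).1 h1
  -- basic facts on `n ∈ T`
  have hn2 : ∀ n ∈ T, 2 ≤ n := fun n hn => (mainSet_props hx hy0 (hmem n hn).1).2.2.1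
  -- the fibre set over `c`
  set Cr := (Icc 1 ⌊z⌋₊).filter (fun c : ℕ =>
    w < (c : ℝ) ∧ c.Coprime k ∧ ∀ p ∈ c.primeFactors, (p : ℝ) < v) with hCr
  have hmaps : ∀ n ∈ T, cPart z n ∈ Cr := by
    intro n hn
    obtain ⟨hmain, -, -, hcw, -⟩ := hmem n hn
    have h2 := hn2 n hn
    have hn0 : n ≠ 0 := by omega
    rw [hCr, Finset.mem_filter, Finset.mem_Icc]
    refine ⟨⟨Nat.one_le_iff_ne_zero.2 cPart_ne_zero, Nat.le_floor (cutPrime_mem h2 hz1).2⟩, hcw,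
      Nat.Coprime.coprime_dvd_left (cPart_dvd hn0) (coprime_of_mem_mainSet hak hmain),
      fun p hp => ?_⟩
    have h1 := lt_of_mem_primeFactors_cPart hp
    exact lt_of_lt_of_le (by exact_mod_cast h1) (hPuv n hn).2
  rw [← Finset.sum_fiberwise_of_maps_to hmaps]
  -- the exponent bound `f(d) ≤ B^{(r+1) M₁}`
  set E := (r + 1) * M₁ with hE
  have hBE : (0 : ℝ) ≤ B ^ E := by positivity
  have hinner : ∀ c ∈ Cr, ∑ n ∈ T.filter (fun n => cPart z n = c), f n ≤
      f c * B ^ E * (C₁ * ((y / c + 1) * (r + 1) / ((Nat.totient k : ℝ) * Real.log z)) + u) := by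
    intro c hc
    rw [hCr, Finset.mem_filter, Finset.mem_Icc] at hc
    obtain ⟨⟨hc1, hcz⟩, -, hck, -⟩ := hc
    have hc0 : c ≠ 0 := by omega
    have hc0' : (0 : ℝ) < c := by exact_mod_cast hc1
    obtain ⟨b, hb⟩ := exists_residue_of_coprime hck hk.ne' a
    set Tc := T.filter (fun n => cPart z n = c) with hTc
    set Dc := (segSet x y c).filter (fun d : ℕ =>
      d ≡ b [MOD k] ∧ ∀ p ∈ Nat.primesBelow ⌈u⌉₊, ¬ p ∣ d) with hDc
    have hTc_mem : ∀ n ∈ Tc, n ∈ T ∧ cPart z n = c := fun n hn => Finset.mem_filter.1 hn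
    -- pointwise bound
    have hpt : ∀ n ∈ Tc, f n ≤ f c * B ^ E := by
      intro n hn
      obtain ⟨hnT, hcn⟩ := hTc_mem n hn
      have h2 := hn2 n hnT
      have hn0 : n ≠ 0 := by omega
      obtain ⟨hxn, hnxy, -, -⟩ := mainSet_props hx hy0 (hmem n hnT).1
      have hsplit : f n = f c * f (dPart z n) := by
        conv_lhs => rw [← cPart_mul_dPart (z := z) hn0]
        rw [hmul _ _ (coprime_cPart_dPart hn0), hcn]
      rw [hsplit]
      refine mul_le_mul_of_nonneg_left ?_ (hf0 c)
      have hd0 : dPart z n ≠ 0 := dPart_ne_zero hn0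
      have hprimes : ∀ p ∈ (dPart z n).primeFactors, u ≤ (p : ℝ) := by
        intro p hp
        have h1 := cutPrime_le_of_mem_primeFactors_dPart hn0 hp
        have h2 : (cutPrime z n : ℝ) ≤ p := by exact_mod_cast h1
        linarith [(hPuv n hnT).1]
      have hdX : ((dPart z n : ℕ) : ℝ) ≤ 2 * x := by
        have : (dPart z n : ℝ) ≤ n := by exact_mod_cast Nat.div_le_self n _
        linarith
      have hΩ := bigOmega_le_div_log hd0 hu1 hprimes hdX
      have hΩE : (bigOmega (dPart z n) : ℝ) ≤ E := by
        refine hΩ.trans ?_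
        rw [hlogu, div_div_eq_mul_div, hE]
        push_cast
        calc Real.log (2 * x) * (r + 1) / Real.log z = (r + 1) * (Real.log (2 * x) / Real.log z) := by
              ring
          _ ≤ (r + 1) * M₁ := mul_le_mul_of_nonneg_left hM₁ (by positivity)
      have hΩE' : bigOmega (dPart z n) ≤ E := by exact_mod_cast hΩE
      exact (le_pow_bigOmega hf0 hf1 hmul hB hd0).trans (pow_le_pow_right₀ hB1 hΩE')
    -- cardinality
    have hcard : #Tc ≤ #Dc := by
      refine card_le_card_of_div (c := c) (fun n hn => ?_) (fun n hn => ?_)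
      · obtain ⟨hnT, hcn⟩ := hTc_mem n hn
        rw [← hcn]
        exact cPart_dvd (by have := hn2 n hnT; omega)
      · obtain ⟨hnT, hcn⟩ := hTc_mem n hn
        have h2 := hn2 n hnT
        have hn0 : n ≠ 0 := by omega
        have hmain := (hmem n hnT).1
        have hdvd : c ∣ n := hcn ▸ cPart_dvd hn0
        rw [hDc, Finset.mem_filter]
        refine ⟨div_mem_segSet hx hy0 hmain hc0 hdvd, ?_, ?_⟩
        · rw [← hb, Nat.mul_div_cancel' hdvd]
          exact (mem_mainSet.1 hmain).2.2
        · intro p hp hpd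
          obtain ⟨hpu, hpp⟩ := Nat.mem_primesBelow.1 hp
          have hpu' : (p : ℝ) < u := Nat.lt_ceil.1 hpu
          have hd : n / c = dPart z n := by rw [dPart, hcn]
          rw [hd] at hpd
          have hpf : p ∈ (dPart z n).primeFactors :=
            Nat.mem_primeFactors.2 ⟨hpp, hpd, dPart_ne_zero hn0⟩
          have h1 := cutPrime_le_of_mem_primeFactors_dPart hn0 hpf
          have h2 : (cutPrime z n : ℝ) ≤ p := by exact_mod_cast h1
          linarith [(hPuv n hnT).1]
    -- the sieve of level `u`
    obtain ⟨hseg1, hseg2⟩ := segSet_length_le hx hy0 hc0 (x := x) (y := y)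
    have hD : (#Dc : ℝ) ≤ C₁ * ((y / c + 1) * (r + 1) / ((Nat.totient k : ℝ) * Real.log z)) + u := by
      have := hsieve b _ _ hseg1 u hu2
      refine this.trans (add_le_add (mul_le_mul_of_nonneg_left ?_ hC₁.le) le_rfl)
      rw [hlogu]
      rw [show (Nat.totient k : ℝ) * (Real.log z / (r + 1)) = (Nat.totient k : ℝ) * Real.log z / (r + 1)
        by ring, div_div_eq_mul_div]
      exact div_le_div_of_nonneg_right (mul_le_mul_of_nonneg_right hseg2 (by positivity))
        (by positivity)
    have hcard' : (#Tc : ℝ) ≤ #Dc := by exact_mod_cast hcard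
    have hfcB : 0 ≤ f c * B ^ E := mul_nonneg (hf0 c) hBE
    calc ∑ n ∈ Tc, f n ≤ ∑ n ∈ Tc, f c * B ^ E := Finset.sum_le_sum hpt
      _ = #Tc * (f c * B ^ E) := by rw [Finset.sum_const, nsmul_eq_mul]
      _ ≤ #Dc * (f c * B ^ E) := mul_le_mul_of_nonneg_right hcard' hfcB
      _ ≤ (C₁ * ((y / c + 1) * (r + 1) / ((Nat.totient k : ℝ) * Real.log z)) + u) * (f c * B ^ E) :=
          mul_le_mul_of_nonneg_right hD hfcB
      _ = f c * B ^ E * (C₁ * ((y / c + 1) * (r + 1) / ((Nat.totient k : ℝ) * Real.log z)) + u) :=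
          mul_comm _ _
  -- sum the inner bounds
  have hstep : ∀ c ∈ Cr, f c * B ^ E * (C₁ * ((y / c + 1) * (r + 1) / ((Nat.totient k : ℝ) * Real.log z)) + u) ≤
      B ^ E * (C₁ * (r + 1) * (y + z) / ((Nat.totient k : ℝ) * Real.log z) + z ^ (1 / 3 : ℝ) * z) *
        (f c / c) := by
    intro c hc
    rw [hCr, Finset.mem_filter, Finset.mem_Icc] at hc
    obtain ⟨⟨hc1, hcz⟩, -⟩ := hc
    have hc0' : (0 : ℝ) < c := by exact_mod_cast hc1
    have hcz' : (c : ℝ) ≤ z := (Nat.le_floor_iff hz0.le).1 hcz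
    have hg : 0 ≤ f c / c := div_nonneg (hf0 c) hc0'.le
    have heq : f c * B ^ E * (C₁ * ((y / c + 1) * (r + 1) / ((Nat.totient k : ℝ) * Real.log z)) + u) =
        B ^ E * (C₁ * (r + 1) * (y + c) / ((Nat.totient k : ℝ) * Real.log z) + u * c) * (f c / c) := by
      field_simp
    rw [heq]
    gcongr
  have hsumC : ∑ c ∈ Cr, f c / c ≤ Real.exp (-(K₁ * r / 2)) * LamIV f z k B K₁ A := by
    have h := rankin_tail hf0 hf1 hmul hB1 hB hA hη0 hη6 hv2 hw0 k (S := Cr)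
      (fun c hc => by
        have := (Finset.mem_Icc.1 (Finset.mem_filter.1 hc).1).1; omega)
      (fun c hc => (Finset.mem_filter.1 hc).2.1.le)
      (fun c hc => (Finset.mem_filter.1 hc).2.2.1)
      (fun c hc => (Finset.mem_filter.1 hc).2.2.2)
    refine h.trans ?_
    -- `w^{-η} = e^{-K₁ r/2}`
    have hwη : w ^ (-η) = Real.exp (-(K₁ * r / 2)) := by
      rw [Real.rpow_def_of_pos hw0]
      congr 1
      have : Real.log w = Real.log z / 2 := by rw [hlogw]; ring
      rw [this, hη]
      field_simp
    rw [hwη, LamIV]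
    refine mul_le_mul_of_nonneg_left (Real.exp_le_exp.2 ?_) (Real.exp_pos _).le
    -- compare the exponents
    have hE1 : ∑ p ∈ primesBelowNotDvd v k, f p / p ≤ ∑ p ∈ primesBelowNotDvd ((⌊z⌋₊ : ℝ) + 1) k, f p / p := by
      refine Finset.sum_le_sum_of_subset_of_nonneg (fun p hp => ?_) (fun p _ _ => by
        exact div_nonneg (hf0 p) (Nat.cast_nonneg p))
      rw [mem_primesBelowNotDvd] at hp ⊢
      refine ⟨hp.1, ?_, hp.2.2⟩
      have h1 : (p : ℝ) ≤ z := by linarith [hp.2.1]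
      have h2 : p ≤ ⌊z⌋₊ := Nat.le_floor h1
      have h3 : ((p : ℕ) : ℝ) ≤ (⌊z⌋₊ : ℝ) := by exact_mod_cast h2
      linarith
    have hvη : v ^ η = Real.exp K₁ := by
      rw [Real.rpow_def_of_pos hv0, hlogv, hη]
      congr 1
      field_simp
    have hlog4 : η * Real.log 4 ≤ 1 := by
      have h4 : Real.log 4 ≤ 3 := by
        have := Real.log_le_sub_one_of_pos (by norm_num : (0 : ℝ) < 4); linarith
      have : η * Real.log 4 ≤ 1 / 6 * 3 :=
        mul_le_mul hη6 h4 (Real.log_nonneg (by norm_num)) (by norm_num)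
      linarith
    have hηv : η * Real.log v = K₁ := by
      rw [hlogv, hη]; field_simp
    have hE2 : B * η * v ^ η * (Real.log v + Real.log 4) ≤ B * Real.exp K₁ * (K₁ + 1) := by
      have : B * η * v ^ η * (Real.log v + Real.log 4) =
          B * Real.exp K₁ * (η * Real.log v + η * Real.log 4) := by rw [hvη]; ring
      rw [this, hηv]
      refine mul_le_mul_of_nonneg_left (by linarith) (by positivity)
    linarith
  calc ∑ c ∈ Cr, ∑ n ∈ T.filter (fun n => cPart z n = c), f n
      ≤ ∑ c ∈ Cr, f c * B ^ E * (C₁ * ((y / c + 1) * (r + 1) / ((Nat.totient k : ℝ) * Real.log z)) + u) :=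
        Finset.sum_le_sum hinner
    _ ≤ ∑ c ∈ Cr, B ^ E * (C₁ * (r + 1) * (y + z) / ((Nat.totient k : ℝ) * Real.log z) +
          z ^ (1 / 3 : ℝ) * z) * (f c / c) := Finset.sum_le_sum hstep
    _ = B ^ E * (C₁ * (r + 1) * (y + z) / ((Nat.totient k : ℝ) * Real.log z) + z ^ (1 / 3 : ℝ) * z) *
          ∑ c ∈ Cr, f c / c := by rw [Finset.mul_sum]
    _ ≤ B ^ E * (C₁ * (r + 1) * (y + z) / ((Nat.totient k : ℝ) * Real.log z) + z ^ (1 / 3 : ℝ) * z) *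
          (Real.exp (-(K₁ * r / 2)) * LamIV f z k B K₁ A) :=
        mul_le_mul_of_nonneg_left hsumC (by positivity)
    _ = _ := by rw [hE]; ring

/-- The saving: with `K₁ = 2 M₁ log B + 4 log 2`,
`B^{(r+1)M₁} e^{-K₁ r/2} = B^{M₁} / 4^r`. [folklore] -/
theorem pow_mul_exp_neg_eq {B : ℝ} (hB : 0 < B) (M₁ r : ℕ) :
    B ^ ((r + 1) * M₁) * Real.exp (-((2 * M₁ * Real.log B + 4 * Real.log 2) * r / 2)) =
      B ^ M₁ / 4 ^ r := by
  have h1 : (2 * M₁ * Real.log B + 4 * Real.log 2) * r / 2 = r * (M₁ * Real.log B + 2 * Real.log 2) := by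
    ring
  have h2 : Real.exp (M₁ * Real.log B + 2 * Real.log 2) = B ^ M₁ * 4 := by
    rw [Real.exp_add, Real.exp_nat_mul, Real.exp_log hB, show (2 : ℝ) * Real.log 2 = ((2 : ℕ) : ℝ) * Real.log 2
      by norm_num, Real.exp_nat_mul, Real.exp_log two_pos]
    norm_num
  rw [h1, Real.exp_neg, Real.exp_nat_mul, h2, mul_pow, add_mul, one_mul, pow_add, pow_mul']
  have hB0 : (B ^ M₁) ^ r ≠ 0 := pow_ne_zero _ (pow_ne_zero _ hB.ne')
  field_simp

/-- `(r + 1)/4^r ≤ (1/2)^r`. [folklore] -/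
theorem succ_div_four_pow_le (r : ℕ) : ((r : ℝ) + 1) / 4 ^ r ≤ (1 / 2 : ℝ) ^ r := by
  have h1 : ((r : ℝ) + 1) ≤ 2 ^ r := by exact_mod_cast succ_le_two_pow r
  have h4 : (4 : ℝ) ^ r = 2 ^ r * 2 ^ r := by rw [← mul_pow]; norm_num
  rw [h4, one_div_pow, div_le_div_iff₀ (by positivity) (by positivity), one_mul]
  exact mul_le_mul_of_nonneg_right h1 (by positivity)

/-- **Class IV** (Shiu 1980, §5, `∑_{IV}`): summing `classIV_r_bound` over
`r = ⌊log z / log P_n⌋ ≤ log z / log L` with `K₁ = 2 M₁ log B + 4 log 2`, the saving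
`e^{-K₁ r/2}` turns `B^{(r+1)M₁}(r+1)` into `B^{M₁} 2^{-r}`, a convergent series.
[cite: Shiu1980, §5 (∑_IV)] -/
theorem classIV_bound {f : ℕ → ℝ} (hf0 : ∀ n, 0 ≤ f n) (hf1 : f 1 = 1)
    (hmul : ∀ m n : ℕ, m.Coprime n → f (m * n) = f m * f n)
    {B : ℝ} (hB1 : 1 ≤ B) (hB : ∀ p l : ℕ, p.Prime → 1 ≤ l → f (p ^ l) ≤ B ^ l)
    {A : ℝ} (hA : ∀ n : ℕ, 1 ≤ n → f n ≤ A * (n : ℝ) ^ (1 / 6 : ℝ))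
    {x y z w L : ℝ} (hx : 1 ≤ x) (hy : 0 < y) (hyx : y ≤ x) (hw : 2 ≤ w)
    (hwz : w * w = z) (hL : 4 ≤ L)
    {k a : ℕ} (hk : 0 < k) (hak : a.Coprime k)
    {M₁ : ℕ} (hM₁ : Real.log (2 * x) / Real.log z ≤ M₁)
    (hLK : 6 * (2 * M₁ * Real.log B + 4 * Real.log 2) ≤ Real.log L) {C₁ : ℝ} (hC₁ : 0 < C₁)
    (hsieve : ∀ (b X₁ X₂ : ℕ), X₁ ≤ X₂ → ∀ (u : ℝ), 2 ≤ u →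
      (#((Ioc X₁ X₂).filter fun d : ℕ => d ≡ b [MOD k] ∧ ∀ p ∈ Nat.primesBelow ⌈u⌉₊, ¬ p ∣ d) : ℝ) ≤
        C₁ * (((X₂ : ℝ) - X₁) / ((Nat.totient k : ℝ) * Real.log u)) + u) :
    ∑ n ∈ (mainSet x y k a).filter (fun n => L < (cutPrime z n : ℝ) ∧ (cutPrime z n : ℝ) ≤ w ∧
        w < (cPart z n : ℝ)), f n ≤
      2 * B ^ M₁ * (C₁ * (y + z) / ((Nat.totient k : ℝ) * Real.log z) + z ^ (1 / 3 : ℝ) * z) *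
        LamIV f z k B (2 * M₁ * Real.log B + 4 * Real.log 2) A := by
  set K₁ : ℝ := 2 * M₁ * Real.log B + 4 * Real.log 2 with hK₁
  set T := (mainSet x y k a).filter (fun n => L < (cutPrime z n : ℝ) ∧ (cutPrime z n : ℝ) ≤ w ∧
        w < (cPart z n : ℝ)) with hT
  have hB0 : 0 < B := by linarith
  have hK₁0 : 0 ≤ K₁ := by
    have h1 : 0 ≤ Real.log B := Real.log_nonneg hB1
    have h2 : 0 ≤ Real.log 2 := Real.log_nonneg one_le_two
    positivity
  have hy0 : 0 ≤ y := hy.le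
  have hz4 : 4 ≤ z := by nlinarith
  have hz0 : 0 < z := by linarith
  have hlogz : 0 < Real.log z := Real.log_pos (by linarith)
  have hlogL : 0 < Real.log L := Real.log_pos (by linarith)
  have hφ : (0 : ℝ) < Nat.totient k := by exact_mod_cast Nat.totient_pos.2 hk
  -- fibre by `r`
  set R := ⌊Real.log z / Real.log L⌋₊ with hR
  set ρ : ℕ → ℕ := fun n => ⌊Real.log z / Real.log (cutPrime z n)⌋₊ with hρ
  have hmaps : ∀ n ∈ T, ρ n ∈ Finset.range (R + 1) := by
    intro n hn
    obtain ⟨-, hLP, -, -⟩ := Finset.mem_filter.1 hn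
    rw [Finset.mem_range, Nat.lt_succ_iff, hρ, hR]
    refine Nat.floor_le_floor (div_le_div_of_nonneg_left hlogz.le hlogL ?_)
    exact Real.log_le_log (by linarith) hLP.le
  rw [← Finset.sum_fiberwise_of_maps_to hmaps]
  -- each fibre
  set Y := (y + z) / ((Nat.totient k : ℝ) * Real.log z) with hY
  set Z := z ^ (1 / 3 : ℝ) * z with hZ
  have hY0 : 0 ≤ Y := by positivity
  have hZ0 : 0 ≤ Z := by positivity
  have hΛ : 0 < LamIV f z k B K₁ A := Real.exp_pos _
  have hfib : ∀ r ∈ Finset.range (R + 1), ∑ n ∈ T.filter (fun n => ρ n = r), f n ≤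
      B ^ M₁ * (1 / 2 : ℝ) ^ r * (C₁ * Y + Z) * LamIV f z k B K₁ A := by
    intro r _
    have hset : T.filter (fun n => ρ n = r) = (mainSet x y k a).filter (fun n =>
        L < (cutPrime z n : ℝ) ∧ (cutPrime z n : ℝ) ≤ w ∧ w < (cPart z n : ℝ) ∧
          ⌊Real.log z / Real.log (cutPrime z n)⌋₊ = r) := by
      rw [hT, Finset.filter_filter]
      simp only [and_assoc, hρ]
    rw [hset]
    have h := classIV_r_bound hf0 hf1 hmul hB1 hB hA hx hy hyx hw hwz hL hk hak hM₁ hK₁0 hLK hC₁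
      hsieve r
    refine h.trans ?_
    rw [hK₁, pow_mul_exp_neg_eq hB0 M₁ r, ← hK₁]
    have hC₁Y : C₁ * (r + 1) * (y + z) / ((Nat.totient k : ℝ) * Real.log z) + z ^ (1 / 3 : ℝ) * z ≤
        ((r : ℝ) + 1) * (C₁ * Y + Z) := by
      rw [hY, hZ]
      have h1 : z ^ (1 / 3 : ℝ) * z ≤ ((r : ℝ) + 1) * (z ^ (1 / 3 : ℝ) * z) := by
        have : (1 : ℝ) ≤ (r : ℝ) + 1 := by linarith [(Nat.cast_nonneg r : (0 : ℝ) ≤ r)]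
        nlinarith
      have h2 : C₁ * (r + 1) * (y + z) / ((Nat.totient k : ℝ) * Real.log z) =
          ((r : ℝ) + 1) * (C₁ * ((y + z) / ((Nat.totient k : ℝ) * Real.log z))) := by ring
      rw [h2]
      nlinarith
    have hBM : 0 ≤ B ^ M₁ / 4 ^ r := by positivity
    calc B ^ M₁ / 4 ^ r * (C₁ * (r + 1) * (y + z) / ((Nat.totient k : ℝ) * Real.log z) +
          z ^ (1 / 3 : ℝ) * z) * LamIV f z k B K₁ A
        ≤ B ^ M₁ / 4 ^ r * (((r : ℝ) + 1) * (C₁ * Y + Z)) * LamIV f z k B K₁ A := by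
          gcongr
      _ = B ^ M₁ * (((r : ℝ) + 1) / 4 ^ r) * (C₁ * Y + Z) * LamIV f z k B K₁ A := by ring
      _ ≤ B ^ M₁ * (1 / 2 : ℝ) ^ r * (C₁ * Y + Z) * LamIV f z k B K₁ A := by
          gcongr
          exact succ_div_four_pow_le r
  refine (Finset.sum_le_sum hfib).trans ?_
  have hgeom := sum_geometric_two_le (R + 1)
  calc ∑ r ∈ Finset.range (R + 1), B ^ M₁ * (1 / 2 : ℝ) ^ r * (C₁ * Y + Z) * LamIV f z k B K₁ A
      = B ^ M₁ * (C₁ * Y + Z) * LamIV f z k B K₁ A * ∑ r ∈ Finset.range (R + 1), (1 / 2 : ℝ) ^ r := by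
        rw [Finset.mul_sum]; refine Finset.sum_congr rfl fun r _ => by ring
    _ ≤ B ^ M₁ * (C₁ * Y + Z) * LamIV f z k B K₁ A * 2 :=
        mul_le_mul_of_nonneg_left hgeom (by positivity)
    _ = 2 * B ^ M₁ * (C₁ * (y + z) / ((Nat.totient k : ℝ) * Real.log z) + z ^ (1 / 3 : ℝ) * z) *
        LamIV f z k B K₁ A := by rw [hY, hZ]; ring

/-! ### From the class bounds to `y/(φ(q) log x) · exp(E)` -/

/-- The exponent of the theorem, `E = ∑_{p ≤ x, p ∤ q} f(p)/p`. [cite: Shiu1980, Theorem 1] -/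
def Esum (f : ℕ → ℝ) (x : ℝ) (q : ℕ) : ℝ :=
  ∑ p ∈ (Icc 1 ⌊x⌋₊).filter (fun p : ℕ => p.Prime ∧ ¬ p ∣ q), f p / p

/-- `E ≥ 0` for `f ≥ 0`. [folklore] -/
theorem Esum_nonneg {f : ℕ → ℝ} (hf0 : ∀ n, 0 ≤ f n) (x : ℝ) (q : ℕ) : 0 ≤ Esum f x q :=
  Finset.sum_nonneg fun p _ => div_nonneg (hf0 p) (Nat.cast_nonneg p)

/-- The partial exponent over `p ≤ ⌊z⌋` is at most `E` when `z ≤ x`. [folklore] -/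
theorem sum_primesBelowNotDvd_le_Esum {f : ℕ → ℝ} (hf0 : ∀ n, 0 ≤ f n) {z x : ℝ} (hzx : z ≤ x)
    (q : ℕ) : ∑ p ∈ primesBelowNotDvd ((⌊z⌋₊ : ℝ) + 1) q, f p / p ≤ Esum f x q := by
  refine Finset.sum_le_sum_of_subset_of_nonneg (fun p hp => ?_)
    (fun p _ _ => div_nonneg (hf0 p) (Nat.cast_nonneg p))
  rw [mem_primesBelowNotDvd] at hp
  obtain ⟨hpp, hpz, hpq⟩ := hp
  rw [Finset.mem_filter, Finset.mem_Icc]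
  refine ⟨⟨hpp.one_lt.le, ?_⟩, hpp, hpq⟩
  have h1 : (p : ℝ) < (⌊z⌋₊ : ℝ) + 1 := hpz
  have h2 : p < ⌊z⌋₊ + 1 := by exact_mod_cast h1
  exact (Nat.lt_succ_iff.1 h2).trans (Nat.floor_le_floor hzx)

/-- Splitting a nonnegative sum along four exhaustive predicates. [folklore] -/
theorem sum_le_sum_four_filter {s : Finset ℕ} {g : ℕ → ℝ} (hg : ∀ n ∈ s, 0 ≤ g n)
    (p₁ p₂ p₃ p₄ : ℕ → Prop) [DecidablePred p₁] [DecidablePred p₂] [DecidablePred p₃]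
    [DecidablePred p₄] (h : ∀ n ∈ s, p₁ n ∨ p₂ n ∨ p₃ n ∨ p₄ n) :
    ∑ n ∈ s, g n ≤ ∑ n ∈ s.filter p₁, g n + ∑ n ∈ s.filter p₂, g n + ∑ n ∈ s.filter p₃, g n +
      ∑ n ∈ s.filter p₄, g n := by
  simp only [Finset.sum_filter, ← Finset.sum_add_distrib]
  refine Finset.sum_le_sum fun n hn => ?_
  have h0 := hg n hn
  have i1 : 0 ≤ (if p₁ n then g n else 0) := by split_ifs <;> linarith
  have i2 : 0 ≤ (if p₂ n then g n else 0) := by split_ifs <;> linarith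
  have i3 : 0 ≤ (if p₃ n then g n else 0) := by split_ifs <;> linarith
  have i4 : 0 ≤ (if p₄ n then g n else 0) := by split_ifs <;> linarith
  rcases h n hn with h1 | h2 | h3 | h4
  · rw [if_pos h1] at i1 ⊢; linarith
  · rw [if_pos h2] at i2 ⊢; linarith
  · rw [if_pos h3] at i3 ⊢; linarith
  · rw [if_pos h4] at i4 ⊢; linarith

/-- `y^θ ≤ y/φ(q)` for `q < y^{1-θ}`, `y > 0`. [cite: Shiu1980, Theorem 1 (the range k < y^{1-α})] -/
theorem rpow_le_div_totient {y θ : ℝ} (hy : 0 < y) {q : ℕ} (hq : 0 < q) (hqy : (q : ℝ) < y ^ (1 - θ)) :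
    y ^ θ ≤ y / (Nat.totient q : ℝ) := by
  have hφ0 : (0 : ℝ) < Nat.totient q := by exact_mod_cast Nat.totient_pos.2 hq
  have hφq : (Nat.totient q : ℝ) ≤ q := by exact_mod_cast Nat.totient_le q
  rw [le_div_iff₀ hφ0]
  have h1 : y ^ θ * (Nat.totient q : ℝ) ≤ y ^ θ * y ^ (1 - θ) :=
    mul_le_mul_of_nonneg_left (hφq.trans hqy.le) (by positivity)
  rw [← Real.rpow_add hy, add_sub_cancel, Real.rpow_one] at h1
  exact h1

/-- **Class I, final form**: `S_I ≤ B^M e^{K₅} (40 C₁/(θε) + 1) · y/(φ(q) log x) · e^E`. [cite: Shiu1980, §5 (∑_I)] -/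
theorem classI_final {SI B C₁ K y z w x θ ε E E₁ φ : ℝ} {M : ℕ}
    (hS : SI ≤ B ^ M * (C₁ * (y + z) / (φ * Real.log w) + w * z) * Real.exp (E₁ + K))
    (hB : 1 ≤ B) (hC₁ : 0 < C₁) (hy : 0 < y) (hzy : z ≤ y) (hzy0 : 0 ≤ z) (hw0 : 0 ≤ w) (hφ : 0 < φ)
    (hθ : 0 < θ) (hε : 0 < ε) (hlogx : 0 < Real.log x)
    (hlogw : θ * ε / 20 * Real.log x ≤ Real.log w) (hE : E₁ ≤ E)
    (hyφ : y ^ θ ≤ y / φ) (HI : w * z * Real.log x ≤ y ^ θ) :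
    SI ≤ B ^ M * Real.exp K * (40 * C₁ / (θ * ε) + 1) * (y / (φ * Real.log x)) * Real.exp E := by
  have hBM : (1 : ℝ) ≤ B ^ M := one_le_pow₀ hB
  have hlogw0 : 0 < Real.log w := lt_of_lt_of_le (by positivity) hlogw
  have hU : 0 < y / (φ * Real.log x) := by positivity
  -- term 1
  have h1 : C₁ * (y + z) / (φ * Real.log w) ≤ 40 * C₁ / (θ * ε) * (y / (φ * Real.log x)) := by
    have ha : C₁ * (y + z) / (φ * Real.log w) ≤ C₁ * (2 * y) / (φ * Real.log w) := by
      gcongr; linarith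
    refine ha.trans ?_
    rw [div_le_iff₀ (by positivity)]
    have : 40 * C₁ / (θ * ε) * (y / (φ * Real.log x)) * (φ * Real.log w) =
        2 * C₁ * y * ((20 / (θ * ε)) * Real.log w / Real.log x) := by
      field_simp
      ring
    rw [this]
    have hb : 1 ≤ (20 / (θ * ε)) * Real.log w / Real.log x := by
      rw [le_div_iff₀ hlogx, one_mul]
      have := mul_le_mul_of_nonneg_left hlogw (by positivity : (0 : ℝ) ≤ 20 / (θ * ε))
      have heq : 20 / (θ * ε) * (θ * ε / 20 * Real.log x) = Real.log x := by
        field_simp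
      linarith
    have hc : 0 ≤ 2 * C₁ * y := by positivity
    nlinarith
  -- term 2
  have h2 : w * z ≤ y / (φ * Real.log x) := by
    rw [le_div_iff₀ (by positivity)]
    calc w * z * (φ * Real.log x) = (w * z * Real.log x) * φ := by ring
      _ ≤ y ^ θ * φ := mul_le_mul_of_nonneg_right HI hφ.le
      _ ≤ y / φ * φ := mul_le_mul_of_nonneg_right hyφ hφ.le
      _ = y := div_mul_cancel₀ y hφ.ne'
  have h3 : Real.exp (E₁ + K) ≤ Real.exp K * Real.exp E := by
    rw [Real.exp_add, mul_comm]
    exact mul_le_mul_of_nonneg_left (Real.exp_le_exp.2 hE) (Real.exp_pos K).le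
  have h12 : C₁ * (y + z) / (φ * Real.log w) + w * z ≤
      (40 * C₁ / (θ * ε) + 1) * (y / (φ * Real.log x)) := by linarith
  have hmid : 0 ≤ C₁ * (y + z) / (φ * Real.log w) + w * z :=
    add_nonneg (div_nonneg (by positivity) (mul_pos hφ hlogw0).le) (mul_nonneg hw0 hzy0)
  calc SI ≤ B ^ M * (C₁ * (y + z) / (φ * Real.log w) + w * z) * Real.exp (E₁ + K) := hS
    _ ≤ B ^ M * ((40 * C₁ / (θ * ε) + 1) * (y / (φ * Real.log x))) * (Real.exp K * Real.exp E) := by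
        gcongr
    _ = _ := by ring

/-- **Classes II and III, final form**: a bound `F (a (y+1)/q · w^{-1/3} + b w)`-type term is
`≤ 2 y/(φ(q) log x) e^E` under the largeness hypotheses. [cite: Shiu1980, §5 (∑_II, ∑_III)] -/
theorem small_class_final {S T₁ T₂ y x θ φ q E : ℝ} (hS : S ≤ T₁ + T₂)
    (hy : 1 ≤ y) (hφ : 0 < φ) (hφq : φ ≤ q) (hlogx : 0 < Real.log x) (hE : 0 ≤ E)
    (hyφ : y ^ θ ≤ y / φ)
    (H₁ : T₁ * q * Real.log x ≤ y) (H₂ : T₂ * Real.log x ≤ y ^ θ) :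
    S ≤ 2 * (y / (φ * Real.log x)) * Real.exp E := by
  have hq : 0 < q := lt_of_lt_of_le hφ hφq
  have hU : 0 < y / (φ * Real.log x) := by positivity
  have h1 : T₁ ≤ y / (φ * Real.log x) := by
    by_cases hT : 0 ≤ T₁
    · rw [le_div_iff₀ (by positivity)]
      calc T₁ * (φ * Real.log x) ≤ T₁ * (q * Real.log x) :=
            mul_le_mul_of_nonneg_left (mul_le_mul_of_nonneg_right hφq hlogx.le) hT
        _ = T₁ * q * Real.log x := by ring
        _ ≤ y := H₁
    · rw [not_le] at hT
      exact hT.le.trans hU.le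
  have h2 : T₂ ≤ y / (φ * Real.log x) := by
    rw [le_div_iff₀ (by positivity)]
    calc T₂ * (φ * Real.log x) = (T₂ * Real.log x) * φ := by ring
      _ ≤ y ^ θ * φ := mul_le_mul_of_nonneg_right H₂ hφ.le
      _ ≤ y / φ * φ := mul_le_mul_of_nonneg_right hyφ hφ.le
      _ = y := div_mul_cancel₀ y hφ.ne'
  have h3 : (1 : ℝ) ≤ Real.exp E := Real.one_le_exp hE
  nlinarith

/-- **Class IV, final form**: `S_IV ≤ 2 B^{M₁} e^{K'} (20 C₁/(θε) + 1) · y/(φ(q) log x) · e^E`. [cite: Shiu1980, §5 (∑_IV)] -/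
theorem classIV_final {SIV B C₁ K y z x θ ε E E₁ φ : ℝ} {M₁ : ℕ}
    (hS : SIV ≤ 2 * B ^ M₁ * (C₁ * (y + z) / (φ * Real.log z) + z ^ (1 / 3 : ℝ) * z) * Real.exp (E₁ + K))
    (hB : 1 ≤ B) (hC₁ : 0 < C₁) (hy : 0 < y) (hzy : z ≤ y) (hz0 : 0 ≤ z) (hφ : 0 < φ)
    (hθ : 0 < θ) (hε : 0 < ε) (hlogx : 0 < Real.log x)
    (hlogz : θ * ε / 10 * Real.log x ≤ Real.log z) (hE : E₁ ≤ E)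
    (hyφ : y ^ θ ≤ y / φ) (HIV : z ^ (1 / 3 : ℝ) * z * Real.log x ≤ y ^ θ) :
    SIV ≤ 2 * B ^ M₁ * Real.exp K * (20 * C₁ / (θ * ε) + 1) * (y / (φ * Real.log x)) * Real.exp E := by
  have hBM : (1 : ℝ) ≤ B ^ M₁ := one_le_pow₀ hB
  have hlogz0 : 0 < Real.log z := lt_of_lt_of_le (by positivity) hlogz
  have hU : 0 < y / (φ * Real.log x) := by positivity
  have h1 : C₁ * (y + z) / (φ * Real.log z) ≤ 20 * C₁ / (θ * ε) * (y / (φ * Real.log x)) := by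
    have ha : C₁ * (y + z) / (φ * Real.log z) ≤ C₁ * (2 * y) / (φ * Real.log z) := by
      gcongr; linarith
    refine ha.trans ?_
    rw [div_le_iff₀ (by positivity)]
    have : 20 * C₁ / (θ * ε) * (y / (φ * Real.log x)) * (φ * Real.log z) =
        2 * C₁ * y * ((10 / (θ * ε)) * Real.log z / Real.log x) := by
      field_simp
      ring
    rw [this]
    have hb : 1 ≤ (10 / (θ * ε)) * Real.log z / Real.log x := by
      rw [le_div_iff₀ hlogx, one_mul]
      have := mul_le_mul_of_nonneg_left hlogz (by positivity : (0 : ℝ) ≤ 10 / (θ * ε))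
      have heq : 10 / (θ * ε) * (θ * ε / 10 * Real.log x) = Real.log x := by
        field_simp
      linarith
    have hc : 0 ≤ 2 * C₁ * y := by positivity
    nlinarith
  have h2 : z ^ (1 / 3 : ℝ) * z ≤ y / (φ * Real.log x) := by
    rw [le_div_iff₀ (by positivity)]
    calc z ^ (1 / 3 : ℝ) * z * (φ * Real.log x) = (z ^ (1 / 3 : ℝ) * z * Real.log x) * φ := by ring
      _ ≤ y ^ θ * φ := mul_le_mul_of_nonneg_right HIV hφ.le
      _ ≤ y / φ * φ := mul_le_mul_of_nonneg_right hyφ hφ.le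
      _ = y := div_mul_cancel₀ y hφ.ne'
  have h3 : Real.exp (E₁ + K) ≤ Real.exp K * Real.exp E := by
    rw [Real.exp_add, mul_comm]
    exact mul_le_mul_of_nonneg_left (Real.exp_le_exp.2 hE) (Real.exp_pos K).le
  have h12 : C₁ * (y + z) / (φ * Real.log z) + z ^ (1 / 3 : ℝ) * z ≤
      (20 * C₁ / (θ * ε) + 1) * (y / (φ * Real.log x)) := by linarith
  have hmid : 0 ≤ C₁ * (y + z) / (φ * Real.log z) + z ^ (1 / 3 : ℝ) * z := by positivity
  calc SIV ≤ 2 * B ^ M₁ * (C₁ * (y + z) / (φ * Real.log z) + z ^ (1 / 3 : ℝ) * z) * Real.exp (E₁ + K) := hS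
    _ ≤ 2 * B ^ M₁ * ((20 * C₁ / (θ * ε) + 1) * (y / (φ * Real.log x))) * (Real.exp K * Real.exp E) := by
        gcongr
    _ = _ := by ring

/-- **Eventual domination**: `K x^α log x ≤ x^β` for large `x` when `α < β`. [folklore] -/
theorem eventually_mul_rpow_mul_log_le (K : ℝ) {α β : ℝ} (hαβ : α < β) :
    ∀ᶠ x : ℝ in Filter.atTop, K * x ^ α * Real.log x ≤ x ^ β := by
  have ho := isLittleO_log_rpow_atTop (by linarith : 0 < β - α)
  have hc : (0 : ℝ) < 1 / (|K| + 1) := by positivity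
  filter_upwards [ho.bound hc, Filter.eventually_ge_atTop (1 : ℝ)] with x hx hx1
  have hx0 : 0 < x := by linarith
  rw [Real.norm_eq_abs, Real.norm_eq_abs, abs_of_nonneg (Real.log_nonneg hx1),
    abs_of_nonneg (Real.rpow_nonneg hx0.le (β - α))] at hx
  have hsplit : x ^ β = x ^ α * x ^ (β - α) := by
    rw [← Real.rpow_add hx0]; ring_nf
  rw [hsplit]
  have hxa : 0 ≤ x ^ α := by positivity
  calc K * x ^ α * Real.log x ≤ |K| * x ^ α * Real.log x := by
        have := le_abs_self K
        have h0 : 0 ≤ x ^ α * Real.log x := mul_nonneg hxa (Real.log_nonneg hx1)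
        nlinarith
    _ ≤ |K| * x ^ α * (1 / (|K| + 1) * x ^ (β - α)) :=
        mul_le_mul_of_nonneg_left hx (by positivity)
    _ = (|K| / (|K| + 1)) * (x ^ α * x ^ (β - α)) := by ring
    _ ≤ 1 * (x ^ α * x ^ (β - α)) := by
        refine mul_le_mul_of_nonneg_right ?_ (by positivity)
        rw [div_le_one (by positivity)]; linarith
    _ = x ^ α * x ^ (β - α) := one_mul _

/-! ### The main bound at fixed `x, y, q, a` -/

/-- The constant of the theorem. [folklore] -/
def Ctot (B A C₁ θ ε : ℝ) (M M₁ : ℕ) : ℝ :=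
  B ^ M * Real.exp (K₅ A B) * (40 * C₁ / (θ * ε) + 1) + 2 + 2 +
    2 * B ^ M₁ * Real.exp (B * Real.exp (2 * M₁ * Real.log B + 4 * Real.log 2) *
      ((2 * M₁ * Real.log B + 4 * Real.log 2) + 1) + K₅ A B) * (20 * C₁ / (θ * ε) + 1)

set_option maxHeartbeats 800000 in
/-- **Shiu's theorem at fixed `x, y, q, a`**, given the parameters and the largeness
hypotheses: the four classes are bounded by `classI_bound`–`classIV_bound` and converted by
`classI_final`, `small_class_final`, `classIV_final`. [cite: Shiu1980, Theorem 1 (proof, §5)] -/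
theorem main_bound {f : ℕ → ℝ} (hf0 : ∀ n, 0 ≤ f n) (hf1 : f 1 = 1)
    (hmul : ∀ m n : ℕ, m.Coprime n → f (m * n) = f m * f n)
    {B : ℝ} (hB1 : 1 ≤ B) (hB : ∀ p l : ℕ, p.Prime → 1 ≤ l → f (p ^ l) ≤ B ^ l)
    {A : ℝ} (hA : ∀ n : ℕ, 1 ≤ n → f n ≤ A * (n : ℝ) ^ (1 / 6 : ℝ))
    {ε θ : ℝ} (hε : 0 < ε) (hθ : 0 < θ) (hθ1 : θ ≤ 1)
    {x y : ℝ} (hx : 2 ≤ x) (hxy : x ^ ε ≤ y) (hyx : y ≤ x)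
    {q a : ℕ} (hq : 0 < q) (hqy : (q : ℝ) < y ^ (1 - θ)) (haq : a.Coprime q)
    {w z : ℝ} (hw_def : w = y ^ (θ / 20)) (hz_def : z = w * w) (hw2 : 2 ≤ w)
    {F : ℝ} (hF0 : 0 ≤ F) (hF : ∀ n ∈ mainSet x y q a, f n ≤ F)
    {M M₁ : ℕ} (hM : Real.log (2 * x) / Real.log w ≤ M) (hM₁ : Real.log (2 * x) / Real.log z ≤ M₁)
    {L : ℝ} (hL : 4 ≤ L) (hLK : 6 * (2 * M₁ * Real.log B + 4 * Real.log 2) ≤ Real.log L)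
    {N : ℕ} (hLN : L < N) {C₁ : ℝ} (hC₁ : 0 < C₁)
    (hsieve : ∀ (b X₁ X₂ : ℕ), X₁ ≤ X₂ → ∀ (u : ℝ), 2 ≤ u →
      (#((Ioc X₁ X₂).filter fun d : ℕ => d ≡ b [MOD q] ∧ ∀ p ∈ Nat.primesBelow ⌈u⌉₊, ¬ p ∣ d) : ℝ) ≤
        C₁ * (((X₂ : ℝ) - X₁) / ((Nat.totient q : ℝ) * Real.log u)) + u)
    (HI : w * z * Real.log x ≤ y ^ θ) (HII₁ : 14 * F * Real.log x ≤ w ^ (1 / 3 : ℝ))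
    (HII₂ : F * w * Real.log x ≤ y ^ θ) (HIII₁ : 2 * F * KL N * Real.log x ≤ w ^ (1 / 3 : ℝ))
    (HIII₂ : 2 * F * w * KL' N * Real.log x ≤ y ^ θ) (HIV : z ^ (1 / 3 : ℝ) * z * Real.log x ≤ y ^ θ) :
    ∑ n ∈ mainSet x y q a, f n ≤
      Ctot B A C₁ θ ε M M₁ * (y / ((Nat.totient q : ℝ) * Real.log x)) * Real.exp (Esum f x q) := by
  -- basic inequalities
  have hx1 : 1 ≤ x := by linarith
  have hx0 : 0 < x := by linarith
  have hlogx : 0 < Real.log x := Real.log_pos (by linarith)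
  have hy1 : 1 ≤ y := le_trans (Real.one_le_rpow hx1 hε.le) hxy
  have hy0 : 0 < y := by linarith
  have hw0 : 0 < w := by linarith
  have hz4 : 4 ≤ z := by rw [hz_def]; nlinarith
  have hz0 : 0 ≤ z := by linarith
  have hzy : z ≤ y := by
    rw [hz_def, hw_def, ← Real.rpow_add hy0]
    conv_rhs => rw [← Real.rpow_one y]
    exact Real.rpow_le_rpow_of_exponent_le hy1 (by linarith)
  have hzx : z ≤ x := hzy.trans hyx
  have hz1 : 1 ≤ z := by linarith
  have hφ : (0 : ℝ) < Nat.totient q := by exact_mod_cast Nat.totient_pos.2 hq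
  have hφq : (Nat.totient q : ℝ) ≤ q := by exact_mod_cast Nat.totient_le q
  have hyφ := rpow_le_div_totient (θ := θ) hy0 hq hqy
  have hlogy : ε * Real.log x ≤ Real.log y := by
    have := Real.log_le_log (by positivity) hxy
    rwa [Real.log_rpow hx0] at this
  have hlogw : Real.log w = θ / 20 * Real.log y := by rw [hw_def, Real.log_rpow hy0]
  have hlogz : Real.log z = θ / 10 * Real.log y := by
    rw [hz_def, Real.log_mul hw0.ne' hw0.ne', hlogw]; ring
  have hlogw' : θ * ε / 20 * Real.log x ≤ Real.log w := by
    rw [hlogw]; nlinarith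
  have hlogz' : θ * ε / 10 * Real.log x ≤ Real.log z := by
    rw [hlogz]; nlinarith
  have hE := sum_primesBelowNotDvd_le_Esum hf0 hzx q
  have hE0 := Esum_nonneg hf0 x q
  -- the four classes
  have hsplit := sum_le_sum_four_filter (s := mainSet x y q a) (g := f) (fun n _ => hf0 n)
    (fun n => w < (cutPrime z n : ℝ))
    (fun n => (cutPrime z n : ℝ) ≤ w ∧ (cPart z n : ℝ) ≤ w)
    (fun n => (cutPrime z n : ℝ) ≤ L ∧ w < (cPart z n : ℝ))
    (fun n => L < (cutPrime z n : ℝ) ∧ (cutPrime z n : ℝ) ≤ w ∧ w < (cPart z n : ℝ))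
    (fun n _ => by
      by_cases h1 : w < (cutPrime z n : ℝ)
      · exact Or.inl h1
      rw [not_lt] at h1
      by_cases h2 : (cPart z n : ℝ) ≤ w
      · exact Or.inr (Or.inl ⟨h1, h2⟩)
      rw [not_le] at h2
      by_cases h3 : (cutPrime z n : ℝ) ≤ L
      · exact Or.inr (Or.inr (Or.inl ⟨h3, h2⟩))
      rw [not_le] at h3
      exact Or.inr (Or.inr (Or.inr ⟨h3, h1, h2⟩)))
  -- class I
  have hI := classI_bound hf0 hf1 hmul hB1 hB hA hx1 hy0 hyx hz1 hzx hw2 hq haq hM hC₁ hsieve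
  have hI' := classI_final hI hB1 hC₁ hy0 hzy hz0 hw0.le hφ hθ hε hlogx hlogw' hE hyφ HI
  -- class II
  have hII := classII_bound hF0 hF hx1 hy0 hzx hw2 hz_def.symm hq haq (f := f)
  have hII' : ∑ n ∈ (mainSet x y q a).filter
      (fun n => (cutPrime z n : ℝ) ≤ w ∧ (cPart z n : ℝ) ≤ w), f n ≤
      2 * (y / ((Nat.totient q : ℝ) * Real.log x)) * Real.exp (Esum f x q) := by
    have hTT : F * (7 * ((y + 1) / q) * w ^ (-(1 / 3 : ℝ)) + w) =
        F * (7 * ((y + 1) / q) * w ^ (-(1 / 3 : ℝ))) + F * w := mul_add _ _ _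
    rw [hTT] at hII
    refine small_class_final hII hy1 hφ hφq hlogx hE0 hyφ ?_ HII₂
    -- `T₁ q log x = 7 F (y+1) w^{-1/3} log x ≤ (y+1)/2 ≤ y`
    have hq0 : (0 : ℝ) < q := by exact_mod_cast hq
    have hw3 : 0 < w ^ (1 / 3 : ℝ) := Real.rpow_pos_of_pos hw0 _
    have hinv : w ^ (-(1 / 3 : ℝ)) = (w ^ (1 / 3 : ℝ))⁻¹ := Real.rpow_neg hw0.le _
    have hcancel : (y + 1) / q * q = y + 1 := div_mul_cancel₀ _ hq0.ne'
    have heq : F * (7 * ((y + 1) / q) * w ^ (-(1 / 3 : ℝ))) * q * Real.log x =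
        (y + 1) / 2 * ((14 * F * Real.log x) * (w ^ (1 / 3 : ℝ))⁻¹) := by
      rw [hinv]
      calc F * (7 * ((y + 1) / q) * (w ^ (1 / 3 : ℝ))⁻¹) * q * Real.log x
          = F * 7 * ((y + 1) / q * q) * (w ^ (1 / 3 : ℝ))⁻¹ * Real.log x := by ring
        _ = F * 7 * (y + 1) * (w ^ (1 / 3 : ℝ))⁻¹ * Real.log x := by rw [hcancel]
        _ = (y + 1) / 2 * ((14 * F * Real.log x) * (w ^ (1 / 3 : ℝ))⁻¹) := by ring
    rw [heq]
    have h1 : (14 * F * Real.log x) * (w ^ (1 / 3 : ℝ))⁻¹ ≤ 1 := by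
      rw [← div_eq_mul_inv, div_le_one hw3]; exact HII₁
    have h2 : 0 ≤ (y + 1) / 2 := by positivity
    calc (y + 1) / 2 * ((14 * F * Real.log x) * (w ^ (1 / 3 : ℝ))⁻¹) ≤ (y + 1) / 2 * 1 :=
          mul_le_mul_of_nonneg_left h1 h2
      _ ≤ y := by linarith
  -- class III
  have hIII := classIII_bound hF0 hF hx1 hy0 hw2 hz_def.symm hq haq hLN (f := f) (L := L)
  have hIII' : ∑ n ∈ (mainSet x y q a).filter
      (fun n => (cutPrime z n : ℝ) ≤ L ∧ w < (cPart z n : ℝ)), f n ≤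
      2 * (y / ((Nat.totient q : ℝ) * Real.log x)) * Real.exp (Esum f x q) := by
    have hTT : F * (y / q * w ^ (-(1 / 3 : ℝ)) * KL N + 2 * w * KL' N) =
        F * (y / q * w ^ (-(1 / 3 : ℝ)) * KL N) + F * (2 * w * KL' N) := mul_add _ _ _
    rw [hTT] at hIII
    refine small_class_final hIII hy1 hφ hφq hlogx hE0 hyφ ?_ ?_
    · have hq0 : (0 : ℝ) < q := by exact_mod_cast hq
      have hw3 : 0 < w ^ (1 / 3 : ℝ) := Real.rpow_pos_of_pos hw0 _
      have hinv : w ^ (-(1 / 3 : ℝ)) = (w ^ (1 / 3 : ℝ))⁻¹ := Real.rpow_neg hw0.le _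
      have hcancel : y / q * q = y := div_mul_cancel₀ _ hq0.ne'
      have heq : F * (y / q * w ^ (-(1 / 3 : ℝ)) * KL N) * q * Real.log x =
          y / 2 * ((2 * F * KL N * Real.log x) * (w ^ (1 / 3 : ℝ))⁻¹) := by
        rw [hinv]
        calc F * (y / q * (w ^ (1 / 3 : ℝ))⁻¹ * KL N) * q * Real.log x
            = F * (y / q * q) * (w ^ (1 / 3 : ℝ))⁻¹ * KL N * Real.log x := by ring
          _ = F * y * (w ^ (1 / 3 : ℝ))⁻¹ * KL N * Real.log x := by rw [hcancel]
          _ = y / 2 * ((2 * F * KL N * Real.log x) * (w ^ (1 / 3 : ℝ))⁻¹) := by ring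
      rw [heq]
      have h1 : (2 * F * KL N * Real.log x) * (w ^ (1 / 3 : ℝ))⁻¹ ≤ 1 := by
        rw [← div_eq_mul_inv, div_le_one hw3]; exact HIII₁
      have h2 : 0 ≤ y / 2 := by positivity
      calc y / 2 * ((2 * F * KL N * Real.log x) * (w ^ (1 / 3 : ℝ))⁻¹) ≤ y / 2 * 1 :=
            mul_le_mul_of_nonneg_left h1 h2
        _ ≤ y := by linarith
    · calc F * (2 * w * KL' N) * Real.log x = 2 * F * w * KL' N * Real.log x := by ring
        _ ≤ y ^ θ := HIII₂
  -- class IV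
  have hIV := classIV_bound hf0 hf1 hmul hB1 hB hA hx1 hy0 hyx hw2 hz_def.symm hL hq haq hM₁ hLK
    hC₁ hsieve
  rw [LamIV, add_assoc] at hIV
  have hIV' := classIV_final hIV hB1 hC₁ hy0 hzy hz0 hφ hθ hε hlogx hlogz' hE hyφ HIV
  -- total
  refine hsplit.trans ?_
  rw [Ctot]
  linarith [hI', hII', hIII', hIV']

/-- `x^{εκ} ≤ y^κ` from `x^ε ≤ y`. [folklore] -/
theorem rpow_mul_le_rpow {x y ε κ : ℝ} (hx : 0 ≤ x) (hxy : x ^ ε ≤ y) (hκ : 0 ≤ κ) :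
    x ^ (ε * κ) ≤ y ^ κ := by
  rw [Real.rpow_mul hx]
  exact Real.rpow_le_rpow (by positivity) hxy hκ

end Shiu

set_option maxHeartbeats 800000 in
open Shiu in
/-- **Discharge of `Shiu1980BrunTitchmarsh`** (Shiu 1980, Theorem 1; Bordellès Thm 4.17).  The
proof follows Shiu's architecture [cite: Shiu1980, §5]: each `n` in the progression is cut as
`n = c_n d_n` at the largest initial segment `c_n ≤ z = y^{θ/10}` of its factorisation
(`Shiu.cutPrime`, `Shiu.cPart`), and the four classes — I: `P_n > w = z^{1/2}` (sifted segment of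
the progression, `Shiu.segment_sieve_bound` = Shiu's Lemma 2, and the Euler majorant
`∑ f(c)/c ≪ exp ∑ f(p)/p`), II: `P_n, c_n ≤ w` (a prime-power divisor `> w`), III: `c_n > w`,
`P_n ≤ L` (Rankin with a constant smoothness bound), IV: `L < P_n ≤ w` (Rankin's trick with the
uniform exponent `η = K₁ r/log z`, Shiu's Lemma 3 in linearised form, summed over
`r = ⌊log z/log P_n⌋`) — are bounded in `Shiu.classI_bound` … `Shiu.classIV_bound` and assembled in
`Shiu.main_bound`; the constants depend on `A₁, A₂(1/6), A₂(εθ/240), ε, θ` and the threshold `x₀`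
comes from finitely many conditions `K x^α log x ≤ x^β`. [cite: Shiu1980, Theorem 1]
[cite: Bordelles2006, Theorem 4.17] -/
theorem Shiu1980BrunTitchmarsh_holds : Shiu1980BrunTitchmarsh := by
  intro f hf0 hmul A₁ hA₁ A₂ hA₂ ε θ hε hε2 hθ hθ2
  by_cases hf1 : f 1 = 1
  swap
  · -- degenerate case: `f 1 = f 1 ^ 2 ≠ 1` forces `f ≡ 0`
    have hf1' : f 1 = 0 := by
      have h := hmul 1 1 (Nat.coprime_one_left 1)
      rw [mul_one] at h
      have h2 : f 1 * (f 1 - 1) = 0 := by nlinarith [h]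
      rcases mul_eq_zero.1 h2 with h0 | h0
      · exact h0
      · exact absurd (by linarith : f 1 = 1) hf1
    have hzero : ∀ n, f n = 0 := fun n => by
      have h := hmul 1 n (Nat.coprime_one_left n)
      rw [one_mul, hf1', zero_mul] at h
      exact h
    refine ⟨0, 0, fun x y _ _ _ q _ _ a _ => ?_⟩
    rw [Finset.sum_eq_zero (fun n _ => hzero n)]
    simp
  -- constants
  obtain ⟨C₁, hC₁, hsieve⟩ := segment_sieve_bound
  have hA₁0 : 0 ≤ A₁ := by
    have h := hA₁ 2 1 Nat.prime_two le_rfl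
    rw [pow_one, pow_one] at h
    exact (hf0 2).trans h
  set B : ℝ := max A₁ 2 with hB_def
  have hB1 : 1 ≤ B := le_trans one_le_two (le_max_right _ _)
  have hBf : ∀ p l : ℕ, p.Prime → 1 ≤ l → f (p ^ l) ≤ B ^ l := fun p l hp hl =>
    (hA₁ p l hp hl).trans (pow_le_pow_left₀ hA₁0 (le_max_left _ _) l)
  set A : ℝ := A₂ (1 / 6) with hA_def
  have hA : ∀ n : ℕ, 1 ≤ n → f n ≤ A * (n : ℝ) ^ (1 / 6 : ℝ) := hA₂ (1 / 6) (by norm_num)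
  set δ₀ : ℝ := ε * θ / 240 with hδ₀_def
  have hδ₀ : 0 < δ₀ := by positivity
  have hεθ : 0 < ε * θ := mul_pos hε hθ
  have hδ₀1 : δ₀ ≤ 1 := by
    have : ε * θ ≤ 1 := mul_le_one₀ (by linarith) hθ.le (by linarith)
    rw [hδ₀_def]; linarith
  set A₀ : ℝ := A₂ δ₀ with hA₀_def
  have hA₀ : ∀ n : ℕ, 1 ≤ n → f n ≤ A₀ * (n : ℝ) ^ δ₀ := hA₂ δ₀ hδ₀
  have hA₀0 : 0 ≤ A₀ := by
    have h := hA₀ 1 le_rfl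
    rw [hf1, Nat.cast_one, Real.one_rpow, mul_one] at h
    linarith
  set M : ℕ := ⌈40 / (θ * ε)⌉₊ with hM_def
  set M₁ : ℕ := ⌈20 / (θ * ε)⌉₊ with hM₁_def
  set K₁ : ℝ := 2 * M₁ * Real.log B + 4 * Real.log 2 with hK₁_def
  set L : ℝ := Real.exp (6 * K₁) with hL_def
  set N : ℕ := ⌊L⌋₊ + 1 with hN_def
  have hK₁4 : 4 * Real.log 2 ≤ K₁ := by
    have : 0 ≤ 2 * (M₁ : ℝ) * Real.log B := by
      have := Real.log_nonneg hB1; positivity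
    linarith
  have hL4 : 4 ≤ L := by
    have hlog4 : Real.log 4 = 2 * Real.log 2 := by
      rw [show (4 : ℝ) = 2 ^ 2 by norm_num, Real.log_pow]; ring
    have h1 : Real.log 4 ≤ 6 * K₁ := by
      rw [hlog4]; linarith [Real.log_pos one_lt_two]
    calc (4 : ℝ) = Real.exp (Real.log 4) := (Real.exp_log (by norm_num)).symm
      _ ≤ L := Real.exp_le_exp.2 h1
  have hLK : 6 * (2 * M₁ * Real.log B + 4 * Real.log 2) ≤ Real.log L := by
    rw [hL_def, Real.log_exp]
  have hLN : L < N := by rw [hN_def]; push_cast; exact Nat.lt_floor_add_one L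
  -- the threshold
  have hev : ∀ᶠ x : ℝ in Filter.atTop, 2 ≤ x ∧ (2 : ℝ) ^ (20 / θ) ≤ x ^ ε ∧
      1 * x ^ (0 : ℝ) * Real.log x ≤ x ^ (ε * (17 * θ / 20)) ∧
      28 * A₀ * x ^ δ₀ * Real.log x ≤ x ^ (ε * (θ / 60)) ∧
      2 * A₀ * x ^ δ₀ * Real.log x ≤ x ^ (ε * (19 * θ / 20)) ∧
      4 * A₀ * KL N * x ^ δ₀ * Real.log x ≤ x ^ (ε * (θ / 60)) ∧
      4 * A₀ * KL' N * x ^ δ₀ * Real.log x ≤ x ^ (ε * (19 * θ / 20)) ∧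
      1 * x ^ (0 : ℝ) * Real.log x ≤ x ^ (ε * (13 * θ / 15)) := by
    have hδ₁ : δ₀ < ε * (θ / 60) := by rw [hδ₀_def]; linarith
    have hδ₂ : δ₀ < ε * (19 * θ / 20) := by rw [hδ₀_def]; linarith
    refine (Filter.eventually_ge_atTop 2).and (((tendsto_rpow_atTop hε).eventually_ge_atTop _).and
      ((eventually_mul_rpow_mul_log_le 1 (by positivity)).and
      ((eventually_mul_rpow_mul_log_le _ hδ₁).and ((eventually_mul_rpow_mul_log_le _ hδ₂).and
      ((eventually_mul_rpow_mul_log_le _ hδ₁).and ((eventually_mul_rpow_mul_log_le _ hδ₂).and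
      (eventually_mul_rpow_mul_log_le 1 (by positivity))))))))
  obtain ⟨x₀, hx₀⟩ := Filter.eventually_atTop.1 hev
  refine ⟨Ctot B A C₁ θ ε M M₁, x₀, fun x y hx hxy hyx q hq hqy a haq => ?_⟩
  obtain ⟨hx2, h7, e1, e2, e3, e4, e5, e6⟩ := hx₀ x hx
  have hq0 : 0 < q := hq
  have hx0 : 0 < x := by linarith
  have hx1 : 1 ≤ x := by linarith
  have hlogx : 0 < Real.log x := Real.log_pos (by linarith)
  have hy1 : 1 ≤ y := le_trans (Real.one_le_rpow hx1 hε.le) hxy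
  have hy0 : 0 < y := by linarith
  rw [Real.rpow_zero, mul_one, one_mul] at e1 e6
  have hpow : ∀ κ : ℝ, 0 ≤ κ → x ^ (ε * κ) ≤ y ^ κ := fun κ hκ => rpow_mul_le_rpow hx0.le hxy hκ
  -- `w` and `z`
  set w : ℝ := y ^ (θ / 20) with hw_def
  set z : ℝ := w * w with hz_def
  have hw0 : 0 < w := Real.rpow_pos_of_pos hy0 _
  have hw2 : 2 ≤ w := by
    have h1 : ((2 : ℝ) ^ (20 / θ)) ^ (θ / 20) ≤ y ^ (θ / 20) :=
      Real.rpow_le_rpow (by positivity) (h7.trans hxy) (by positivity)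
    have h20 : (20 : ℝ) / θ * (θ / 20) = 1 := by
      rw [div_mul_div_comm, mul_comm (20 : ℝ) θ]
      exact div_self (by positivity)
    rw [← Real.rpow_mul (by norm_num), h20, Real.rpow_one] at h1
    exact h1
  have hzy : z = y ^ (θ / 10) := by
    rw [hz_def, hw_def, ← Real.rpow_add hy0]; ring_nf
  -- `F`
  set F : ℝ := 2 * A₀ * x ^ δ₀ with hF_def
  have hF0 : 0 ≤ F := by positivity
  have hF : ∀ n ∈ mainSet x y q a, f n ≤ F := by
    intro n hn
    obtain ⟨-, hnxy, hn2, -⟩ := mainSet_props hx1 hy0.le hn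
    have hn1 : 1 ≤ n := by omega
    have hn2x : (n : ℝ) ≤ 2 * x := by linarith
    calc f n ≤ A₀ * (n : ℝ) ^ δ₀ := hA₀ n hn1
      _ ≤ A₀ * (2 * x) ^ δ₀ := mul_le_mul_of_nonneg_left
          (Real.rpow_le_rpow (Nat.cast_nonneg n) hn2x hδ₀.le) hA₀0
      _ = A₀ * 2 ^ δ₀ * x ^ δ₀ := by rw [Real.mul_rpow (by norm_num) hx0.le]; ring
      _ ≤ A₀ * 2 * x ^ δ₀ := by
          refine mul_le_mul_of_nonneg_right (mul_le_mul_of_nonneg_left ?_ hA₀0) (by positivity)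
          conv_rhs => rw [← Real.rpow_one 2]
          exact Real.rpow_le_rpow_of_exponent_le one_le_two hδ₀1
      _ = F := by rw [hF_def]; ring
  -- `M`, `M₁`
  have hlogy : ε * Real.log x ≤ Real.log y := by
    have := Real.log_le_log (by positivity) hxy
    rwa [Real.log_rpow hx0] at this
  have hlogw : Real.log w = θ / 20 * Real.log y := by rw [hw_def, Real.log_rpow hy0]
  have hlogz : Real.log z = θ / 10 * Real.log y := by rw [hzy, Real.log_rpow hy0]
  have hlog2x : Real.log (2 * x) ≤ 2 * Real.log x := by
    rw [Real.log_mul two_ne_zero hx0.ne']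
    linarith [Real.log_le_log two_pos hx2]
  have hθε : 0 < θ * ε := mul_pos hθ hε
  have hθlogy : θ * (ε * Real.log x) ≤ θ * Real.log y := mul_le_mul_of_nonneg_left hlogy hθ.le
  have hcancel : 40 / (θ * ε) * (θ * ε) = 40 := div_mul_cancel₀ _ hθε.ne'
  have hM : Real.log (2 * x) / Real.log w ≤ M := by
    have hlw : θ * ε / 20 * Real.log x ≤ Real.log w := by rw [hlogw]; linarith
    have hlw0 : 0 < Real.log w := lt_of_lt_of_le (by positivity) hlw
    rw [div_le_iff₀ hlw0]
    have h1 : (40 / (θ * ε) : ℝ) ≤ M := Nat.le_ceil _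
    have h2 : 2 * Real.log x ≤ 40 / (θ * ε) * Real.log w := by
      have := mul_le_mul_of_nonneg_left hlw (by positivity : (0 : ℝ) ≤ 40 / (θ * ε))
      have heq : 40 / (θ * ε) * (θ * ε / 20 * Real.log x) = 2 * Real.log x := by
        calc 40 / (θ * ε) * (θ * ε / 20 * Real.log x)
            = (40 / (θ * ε) * (θ * ε)) / 20 * Real.log x := by ring
          _ = 2 * Real.log x := by rw [hcancel]; ring
      linarith
    have h3 := mul_le_mul_of_nonneg_right h1 hlw0.le
    linarith
  have hM₁ : Real.log (2 * x) / Real.log z ≤ M₁ := by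
    have hlz : θ * ε / 10 * Real.log x ≤ Real.log z := by rw [hlogz]; linarith
    have hlz0 : 0 < Real.log z := lt_of_lt_of_le (by positivity) hlz
    rw [div_le_iff₀ hlz0]
    have h1 : (20 / (θ * ε) : ℝ) ≤ M₁ := Nat.le_ceil _
    have h2 : 2 * Real.log x ≤ 20 / (θ * ε) * Real.log z := by
      have := mul_le_mul_of_nonneg_left hlz (by positivity : (0 : ℝ) ≤ 20 / (θ * ε))
      have heq : 20 / (θ * ε) * (θ * ε / 10 * Real.log x) = 2 * Real.log x := by
        calc 20 / (θ * ε) * (θ * ε / 10 * Real.log x)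
            = (40 / (θ * ε) * (θ * ε)) / 20 * Real.log x := by ring
          _ = 2 * Real.log x := by rw [hcancel]; ring
      linarith
    have h3 := mul_le_mul_of_nonneg_right h1 hlz0.le
    linarith
  -- the largeness hypotheses
  have hw13 : w ^ (1 / 3 : ℝ) = y ^ (θ / 60) := by
    rw [hw_def, ← Real.rpow_mul hy0.le]; ring_nf
  have HI : w * z * Real.log x ≤ y ^ θ := by
    have h1 : w * z = y ^ (3 * θ / 20) := by
      rw [hzy, hw_def, ← Real.rpow_add hy0]; ring_nf
    have h2 : Real.log x ≤ y ^ (17 * θ / 20) := e1.trans (hpow _ (by positivity))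
    have h3 : y ^ (3 * θ / 20) * y ^ (17 * θ / 20) = y ^ θ := by
      rw [← Real.rpow_add hy0]; ring_nf
    rw [h1, ← h3]
    exact mul_le_mul_of_nonneg_left h2 (by positivity)
  have HII₁ : 14 * F * Real.log x ≤ w ^ (1 / 3 : ℝ) := by
    rw [hw13]
    calc 14 * F * Real.log x = 28 * A₀ * x ^ δ₀ * Real.log x := by rw [hF_def]; ring
      _ ≤ x ^ (ε * (θ / 60)) := e2
      _ ≤ y ^ (θ / 60) := hpow _ (by positivity)
  have hsplitθ : y ^ (19 * θ / 20) * w = y ^ θ := by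
    rw [hw_def, ← Real.rpow_add hy0]; ring_nf
  have HII₂ : F * w * Real.log x ≤ y ^ θ := by
    calc F * w * Real.log x = (2 * A₀ * x ^ δ₀ * Real.log x) * w := by rw [hF_def]; ring
      _ ≤ x ^ (ε * (19 * θ / 20)) * w := mul_le_mul_of_nonneg_right e3 hw0.le
      _ ≤ y ^ (19 * θ / 20) * w := mul_le_mul_of_nonneg_right (hpow _ (by positivity)) hw0.le
      _ = y ^ θ := hsplitθ
  have HIII₁ : 2 * F * KL N * Real.log x ≤ w ^ (1 / 3 : ℝ) := by
    rw [hw13]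
    calc 2 * F * KL N * Real.log x = 4 * A₀ * KL N * x ^ δ₀ * Real.log x := by rw [hF_def]; ring
      _ ≤ x ^ (ε * (θ / 60)) := e4
      _ ≤ y ^ (θ / 60) := hpow _ (by positivity)
  have HIII₂ : 2 * F * w * KL' N * Real.log x ≤ y ^ θ := by
    calc 2 * F * w * KL' N * Real.log x = (4 * A₀ * KL' N * x ^ δ₀ * Real.log x) * w := by
          rw [hF_def]; ring
      _ ≤ x ^ (ε * (19 * θ / 20)) * w := mul_le_mul_of_nonneg_right e5 hw0.le
      _ ≤ y ^ (19 * θ / 20) * w := mul_le_mul_of_nonneg_right (hpow _ (by positivity)) hw0.le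
      _ = y ^ θ := hsplitθ
  have HIV : z ^ (1 / 3 : ℝ) * z * Real.log x ≤ y ^ θ := by
    have h1 : z ^ (1 / 3 : ℝ) * z = y ^ (2 * θ / 15) := by
      rw [hzy, ← Real.rpow_mul hy0.le, ← Real.rpow_add hy0]; ring_nf
    have h2 : Real.log x ≤ y ^ (13 * θ / 15) := e6.trans (hpow _ (by positivity))
    have h3 : y ^ (2 * θ / 15) * y ^ (13 * θ / 15) = y ^ θ := by
      rw [← Real.rpow_add hy0]; ring_nf
    rw [h1, ← h3]
    exact mul_le_mul_of_nonneg_left h2 (by positivity)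
  -- the main bound
  have hmain := main_bound hf0 hf1 hmul hB1 hBf hA hε hθ (by linarith) hx2 hxy hyx hq0 hqy haq
    hw_def hz_def hw2 hF0 hF hM hM₁ hL4 hLK hLN hC₁ (hsieve q hq0) HI HII₁ HII₂ HIII₁ HIII₂ HIV
  -- rewrite the statement's sum and right-hand side
  have hset : (Finset.Icc 1 ⌊x + y⌋₊).filter (fun n : ℕ => x < n ∧ (n : ZMod q) = (a : ZMod q)) =
      mainSet x y q a := by
    ext n
    rw [mem_mainSet, Finset.mem_filter, Finset.mem_Icc, ZMod.natCast_eq_natCast_iff,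
      Nat.floor_lt hx0.le]
    constructor
    · rintro ⟨⟨-, h2⟩, h3, h4⟩
      exact ⟨h3, h2, h4⟩
    · rintro ⟨h1, h2, h3⟩
      have : (1 : ℝ) ≤ n := by linarith
      exact ⟨⟨by exact_mod_cast this, h2⟩, h1, h3⟩
  rw [hset]
  refine hmain.trans (le_of_eq ?_)
  rw [Esum]
  ring

end Literature.NumberTheory.Sieve
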